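import Mathlib
import HarnessLib

/-!
# Consequences of the resonator type inequality WITH DEFECT: the design calculus of the 2001 programme
# ([CV] §§3–4 = W-MAG Prop. 4.3 = swcm Thm. 3.3), for a weight `c ≥ 0` with `d = c − Λ`

This file is the design ("type") calculus by which the 2001 programme (archive `2001`) extracts arithmetic
information about a nonnegative weight `c : ℕ → ℝ` from the **resonator type inequality with defect `D`**:
for every mixture `Φ` of (at most two) product resonators built from local vectors at finitely many primes,

  `Φ(1)·C₁ + ∑ₙ zₙ (Φ(n) − Φ(1)) ≤ D · Φ(1)`,   `zₙ = (c(n) − Λ(n))/n`,  `C₁ = lim_N ∑_{n<N} zₙ`,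

where `Φ(n) = l₁ ∏_{p∈P₁} φ_p[v₁ p](v_p n) + l₂ ∏_{p∈P₂} φ_p[v₂ p](v_p n)` is the product-of-local-profiles
form of the gcd-form profile of a product resonator (`Literature/NumberTheory/LFunctions/GcdFormProfile.lean`,
[CV] Lemma 3.2). In the programme this inequality is the OUTPUT of the analytic machine (the zero-forcing
twisted-second-moment resonator inequality over the explicit formula for Weil's functional; [CV] Prop. 2.4 /
App. A, W-MAG §§2–3, swcm Prop. 3.2) applied to a weight in the `M`-slack Weil cone (`D = M/2`); here it
is a HYPOTHESIS (structure `TypeDesignHypotheses D c`, one field per analytic input), and everything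
downstream is PROVED:

* `C1_le` — the trivial design: `C₁ ≤ D`;
* `prop41_i_summable`, `prop41_i_bound` — the even design: the composite mass `B = ∑_{n composite} c(n)/n` is
  finite, `(τ₂τ₃)·B ≤ D − C₁` ([CV] Prop. 4.1(i), W-MAG Prop. 4.3(i), swcm Thm. 3.3(i));
  `summable_compMass`, `tsum_compMass_le` — its `e₂`-weighted form `∑_{comp} (c(n)/n) e₂(n) ≤ D − C₁`
  (the AX-B input of the W-MAG deficit spine);
* `boost_bound` — boosting: `∑_{p∈Q} τ_p D_p ≤ D − C₁` ([CV] 4.1(ii));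
* `euler_bound` — Euler-factor removal: `C₁ ≤ D + ∑_{p∈R} D_p + B` ([CV] 4.1(iii));
* `threeTerm_bound` — the three-term design: `∑_{p∈Q} τ'_p T₁(p) ≤ D − C₁` ([CV] 4.1(iv));
* `prop41_v` — **ℓ¹-rigidity** `∑ₙ |c(n) − Λ(n)|/n < ∞` ([CV] Prop. 4.1(v), W-MAG Prop. 4.3(v) "AX-A",
  swcm Thm. 3.3(v)); `tsum_z_eq`.

Sources (archive `2001`, all internal, refereed in-programme, UNPUBLISHED — hence `[folklore]` tags on what is
PROVED here and no named facts): `rh-w-composite-vanishing/free/y1` paper §§3–4 (Lemmas 3.2–3.6, Prop. 4.1)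
and its Lean leg `CompositeVanishing.lean` (stockroom copy
`reserve/prior-2001/Prior/RiemannHypothesis/RiemannHypothesis/Rh_WCompositeVanishingY1_CompositeVanishing.lean`,
from which this file is ADAPTED: the defect `D` is threaded through — the stockroom file is the case `D = 0` —
and the `e₂`-form of the composite-mass bound is added); `rh-w-magnification/free/y1` Prop. 4.3;
`summits/rh/routes/slack-weil-cone-magnification/paper/paper.tex` Thm. 3.3 (thm:l1) and Cor. 3.4 ("whose
proof holds for `W_c + Mδ₀` with `½` replaced by `M/2` throughout").

Design choices. The local vectors are written down explicitly (the two-term vector realising every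
`τ ∈ I_p = [−(√p+1)/2, (√p−1)/2]`, [CV] Lemma 3.3(i); the three-term vector with `τ'_p = (p−1)/(2+1/(4p))`,
Lemma 3.3(ii)); the type inequality is assumed only for mixtures of at most two product resonators (all that is
used) and carries its own absolute-summability premise, so that a user who knows the inequality only for
convergent class sums can still instantiate the structure. `c 0 = 0`, `c 1 = 0` encode "`c` lives on
`{2, 3, …}`". NOT here: the analytic derivation of the type inequality; the composite-VANISHING theorem of
[CV] §5 (the case `D = 0`: `c ∈ K` vanishes off the prime powers), which is not needed with defect; the deficit
spine of W-MAG §5 (landed problem-side).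
-/

open scoped BigOperators
open ArithmeticFunction Filter Finset

namespace Literature.NumberTheory.LFunctions

namespace TypeDesign


noncomputable section
open scoped Classical

/-! ## Basic objects -/

/-- `z c n = (c n - Λ n)/n`: the paper's `z_n = d(n)/n = (c(n)-Λ(n))/n` (§1.4).
`z c 0 = 0` (division by zero) and `z c 1 = 0` once `c 1 = 0` (since `Λ 1 = 0`). [folklore] -/
def z (c : ℕ → ℝ) (n : ℕ) : ℝ := (c n - Λ n) / (n : ℝ)

/-- Composite = `n ≥ 2` with at least two distinct prime factors = `n ≥ 2` and not
a prime power (paper §1.1: the two classes partition `{n ≥ 2}`). [folklore] -/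
def IsComposite (n : ℕ) : Prop := 2 ≤ n ∧ ¬IsPrimePow n

/-- The composite weight `c(n)/n` supported on composite integers; its total sum
is the paper's `B = Σ_{n composite} c(n)/n`. [folklore] -/
def cWeight (c : ℕ → ℝ) (n : ℕ) : ℝ := if IsComposite n then c n / (n : ℝ) else 0

/-- One-prime local profile of the vector `v` (supported on `{0,…,m}`) at the
prime `p`, evaluated at `n`:
`Σ_{i,j ≤ m} v i * v j * (√p)^(2·min(v_p(n)+i, j) - i - j)`.
By `gcd_mul_prime_pow` below this is the one-prime factor of the paper's gcd-form
profile `Φ_α(n) = Σ_{ℓ,ℓ'} α_ℓ α_{ℓ'} gcd(nℓ,ℓ')/√(ℓℓ')` (paper Lemma 3.2). [folklore] -/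
def locProfile (p m : ℕ) (v : ℕ → ℝ) (n : ℕ) : ℝ :=
  ∑ i ∈ range (m + 1), ∑ j ∈ range (m + 1),
    v i * v j *
      Real.sqrt (p : ℝ) ^ (2 * ((min (n.factorization p + i) j : ℕ) : ℤ) - (i : ℤ) - (j : ℤ))

/-- The profile of a two-component design: positive weights `l₁, l₂`, prime
supports `P₁, P₂`, per-prime local vectors `v₁ p, v₂ p` with support bounds
`m₁, m₂`.  (Paper Remark 2.6: every design used has at most two components.) [folklore] -/
def designProfile (l₁ l₂ : ℝ) (P₁ P₂ : Finset ℕ) (m₁ m₂ : ℕ)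
    (v₁ v₂ : ℕ → ℕ → ℝ) (n : ℕ) : ℝ :=
  l₁ * ∏ p ∈ P₁, locProfile p m₁ (v₁ p) n + l₂ * ∏ p ∈ P₂, locProfile p m₂ (v₂ p) n

/-- **The type-design hypotheses with defect `D`** of a weight `c : ℕ → ℝ`: the named analytic inputs of the
[CV] §§3–4 / W-MAG §4 design calculus (see the file header). Each field is a statement the 2001 sources prove
for a weight in the `M`-slack Weil cone (`D = M/2`; references in the field docstrings); everything below the
structure is derived from it with no further analytic input. [folklore] -/
structure TypeDesignHypotheses (D : ℝ) (c : ℕ → ℝ) where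
  /-- The constant `C₁ = Σ_n (c(n)-Λ(n))/n` (ordered sum), paper Lemma 2.3(i). [folklore] -/
  C₁ : ℝ
  /-- `c ≥ 0` (part of `c : {2,3,…} → [0,∞)`). [folklore] -/
  nonneg : ∀ n, 0 ≤ c n
  /-- domain convention: `c` is a sequence on `{2,3,…}`, extended by `0`. [folklore] -/
  c_zero : c 0 = 0
  /-- domain convention: `c` is a sequence on `{2,3,…}`, extended by `0`. [folklore] -/
  c_one : c 1 = 0
  /-- Paper Lemma 2.3(ii): `Σ_{k≥1} |z(p^k)| < ∞` for every prime `p`. [folklore] -/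
  summable_pp : ∀ p : ℕ, p.Prime → Summable fun k : ℕ => |z c (p ^ (k + 1))|
  /-- Paper Lemma 3.5: `B_q = Σ_{n composite, q∣n} c(n)/n < ∞` for every prime `q`. [folklore] -/
  summable_comp : ∀ p : ℕ, p.Prime →
    Summable fun n : ℕ => if p ∣ n ∧ IsComposite n then c n / (n : ℝ) else 0
  /-- Paper Lemma 2.3(i): the ordered series `Σ_n z_n` converges, to `C₁`. [folklore] -/
  tendsto_C₁ : Tendsto (fun N => ∑ n ∈ range N, z c n) atTop (nhds C₁)
  /-- The resonator/type inequality WITH DEFECT `D` ([CV] Lemma 3.6(c) / W-MAG Prop. 4.3, eq. (LO) /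
  swcm eq. (typeflat), whose analytic content is the zero-forcing resonator inequality [CV] Prop. 2.4 = W-MAG
  Prop. 3.x = swcm Prop. 3.2, with the slack `M δ₀` carried as the class of type `0` at `n = 1`),
  specialised to mixtures of at most two product resonators and stated at the level of `n`, under its own
  absolute-summability premise: `Φ(1)·C₁ + Σ'_n z_n (Φ(n) − Φ(1)) ≤ D·Φ(1)` for every design profile `Φ`
  (`D = M/2` for a weight in the `M`-slack Weil cone). [folklore] -/
  type_ineq : ∀ (l₁ l₂ : ℝ) (P₁ P₂ : Finset ℕ) (m₁ m₂ : ℕ) (v₁ v₂ : ℕ → ℕ → ℝ),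
    0 < l₁ → 0 < l₂ → (∀ p ∈ P₁, p.Prime) → (∀ p ∈ P₂, p.Prime) →
    Summable (fun n : ℕ => z c n * (designProfile l₁ l₂ P₁ P₂ m₁ m₂ v₁ v₂ n
        - designProfile l₁ l₂ P₁ P₂ m₁ m₂ v₁ v₂ 1)) →
    designProfile l₁ l₂ P₁ P₂ m₁ m₂ v₁ v₂ 1 * C₁ +
      ∑' n : ℕ, z c n * (designProfile l₁ l₂ P₁ P₂ m₁ m₂ v₁ v₂ n
        - designProfile l₁ l₂ P₁ P₂ m₁ m₂ v₁ v₂ 1) ≤ D * designProfile l₁ l₂ P₁ P₂ m₁ m₂ v₁ v₂ 1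

variable {D : ℝ} {c : ℕ → ℝ} {p q n : ℕ}

/-! ## Elementary facts about `z`, `Λ`, composites -/

/-- Auxiliary step of the [CV] §§3–4 design calculus (adapted from the 2001 stockroom Lean leg). [folklore] -/
lemma z_zero : z c 0 = 0 := by simp [z]

/-- Auxiliary step of the [CV] §§3–4 design calculus (adapted from the 2001 stockroom Lean leg). [folklore] -/
lemma z_one (hc1 : c 1 = 0) : z c 1 = 0 := by
  simp [z, hc1, ArithmeticFunction.vonMangoldt_apply_one]

/-- Auxiliary step of the [CV] §§3–4 design calculus (adapted from the 2001 stockroom Lean leg). [folklore] -/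
lemma z_eq_of_comp (h : IsComposite n) : z c n = c n / (n : ℝ) := by
  have hΛ : Λ n = 0 := ArithmeticFunction.vonMangoldt_eq_zero_iff.mpr h.2
  simp [z, hΛ]

/-- Auxiliary step of the [CV] §§3–4 design calculus (adapted from the 2001 stockroom Lean leg). [folklore] -/
lemma z_nonneg_of_comp (hc : ∀ k, 0 ≤ c k) (h : IsComposite n) : 0 ≤ z c n := by
  rw [z_eq_of_comp h]
  have hn : (0:ℝ) < n := by exact_mod_cast lt_of_lt_of_le (by norm_num) h.1
  exact div_nonneg (hc n) hn.le

/-- `-z(n) ≤ Λ(n)/n` for all `n` (the only use of `c ≥ 0` at prime powers). [folklore] -/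
lemma neg_z_le (hc : ∀ k, 0 ≤ c k) (n : ℕ) : -z c n ≤ Λ n / (n : ℝ) := by
  rcases Nat.eq_zero_or_pos n with h0 | hpos
  · subst h0; simp [z]
  · have hn : (0:ℝ) < n := by exact_mod_cast hpos
    rw [z, ← neg_div, neg_sub]
    have hcn := hc n
    gcongr
    linarith

/-- Auxiliary step of the [CV] §§3–4 design calculus (adapted from the 2001 stockroom Lean leg). [folklore] -/
lemma vonMangoldt_prime_pow (hp : p.Prime) (k : ℕ) :
    Λ (p ^ (k + 1)) = Real.log p := by
  rw [ArithmeticFunction.vonMangoldt_apply_pow (Nat.succ_ne_zero k),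
    ArithmeticFunction.vonMangoldt_apply_prime hp]

/-- A prime power has a unique prime divisor. [folklore] -/
lemma prime_eq_of_dvd_isPrimePow (hn : IsPrimePow n) (hp : p.Prime) (hq : q.Prime)
    (hpd : p ∣ n) (hqd : q ∣ n) : p = q := by
  obtain ⟨r, k, hr, hk, rfl⟩ := (isPrimePow_nat_iff n).mp hn
  have h1 : p = r := (Nat.prime_dvd_prime_iff_eq hp hr).mp (hp.dvd_of_dvd_pow hpd)
  have h2 : q = r := (Nat.prime_dvd_prime_iff_eq hq hr).mp (hq.dvd_of_dvd_pow hqd)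
  rw [h1, h2]

/-- A composite integer has two distinct prime factors. [folklore] -/
lemma exists_two_primeFactors (h : IsComposite n) :
    ∃ p q, p ∈ n.primeFactors ∧ q ∈ n.primeFactors ∧ p ≠ q := by
  obtain ⟨h2, hpp⟩ := h
  have hcard1 : n.primeFactors.card ≠ 1 := fun h1 =>
    hpp (isPrimePow_iff_card_primeFactors_eq_one.mpr h1)
  have hone : 1 < n.primeFactors.card := by
    rcases Nat.eq_zero_or_pos n.primeFactors.card with h0 | hpos
    · rw [Finset.card_eq_zero, Nat.primeFactors_eq_empty] at h0
      rcases h0 with rfl | rfl <;> omega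
    · rcases Nat.lt_or_ge 1 n.primeFactors.card with h' | h'
      · exact h'
      · exact absurd (le_antisymm h' hpos) hcard1
  obtain ⟨a, ha, b, hb, hab⟩ := Finset.one_lt_card.mp hone
  exact ⟨a, b, ha, hb, hab⟩

/-! ## The gcd cross-check: `locProfile` is the one-prime factor of the paper's
gcd form (paper Lemma 3.2(a), one-prime case). -/

/-- Auxiliary step of the [CV] §§3–4 design calculus (adapted from the 2001 stockroom Lean leg). [folklore] -/
lemma gcd_mul_prime_pow (hp : p.Prime) (hn : n ≠ 0) (i j : ℕ) :
    Nat.gcd (n * p ^ i) (p ^ j) = p ^ min (n.factorization p + i) j := by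
  have hnp : n * p ^ i ≠ 0 := mul_ne_zero hn (pow_ne_zero _ hp.pos.ne')
  have hpj : p ^ j ≠ 0 := pow_ne_zero _ hp.pos.ne'
  -- the gcd divides `p^j`, so it is a power of `p`
  obtain ⟨k, hkj, hk⟩ := (Nat.dvd_prime_pow hp).mp (Nat.gcd_dvd_right (n * p ^ i) (p ^ j))
  -- compute its exponent via factorizations
  have hfact : (Nat.gcd (n * p ^ i) (p ^ j)).factorization p
      = min (n.factorization p + i) j := by
    rw [Nat.factorization_gcd hnp hpj, Finsupp.inf_apply,
      Nat.factorization_mul hn (pow_ne_zero _ hp.pos.ne'), Finsupp.add_apply,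
      hp.factorization_pow, Finsupp.single_eq_same, hp.factorization_pow,
      Finsupp.single_eq_same]
  rw [hk] at hfact
  rw [hp.factorization_pow, Finsupp.single_eq_same] at hfact
  rw [hk, hfact]

/-- Term-level identity with the paper's normalisation `gcd(n·p^i, p^j)/√(p^i p^j)`. [folklore] -/
lemma term_eq_gcd_form (hp : p.Prime) (hn : n ≠ 0) (i j : ℕ) :
    Real.sqrt (p : ℝ) ^ (2 * ((min (n.factorization p + i) j : ℕ) : ℤ) - (i : ℤ) - (j : ℤ))
      = (Nat.gcd (n * p ^ i) (p ^ j) : ℝ) / Real.sqrt (p : ℝ) ^ ((i : ℤ) + (j : ℤ)) := by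
  have hs : (0:ℝ) < Real.sqrt (p : ℝ) :=
    Real.sqrt_pos.mpr (by exact_mod_cast hp.pos)
  rw [gcd_mul_prime_pow hp hn i j]
  have hnum : ((p ^ min (n.factorization p + i) j : ℕ) : ℝ)
      = Real.sqrt (p:ℝ) ^ (2 * min (n.factorization p + i) j : ℕ) := by
    push_cast
    rw [pow_mul, Real.sq_sqrt (by positivity)]
  rw [hnum, ← zpow_natCast (Real.sqrt (p:ℝ)) (2 * min (n.factorization p + i) j),
    ← zpow_sub₀ hs.ne']
  congr 1
  push_cast
  ring

/-! ## Explicit expansion of the small local profiles -/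

/-- Auxiliary step of the [CV] §§3–4 design calculus (adapted from the 2001 stockroom Lean leg). [folklore] -/
lemma sumR2' (f : ℕ → ℝ) : ∑ i ∈ range (1 + 1), f i = f 0 + f 1 := by
  rw [Finset.sum_range_succ, Finset.sum_range_one]

/-- Auxiliary step of the [CV] §§3–4 design calculus (adapted from the 2001 stockroom Lean leg). [folklore] -/
lemma sumR2 (f : ℕ → ℝ) : ∑ i ∈ range 2, f i = f 0 + f 1 := by
  show ∑ i ∈ range (1 + 1), f i = f 0 + f 1
  exact sumR2' f

/-- Auxiliary step of the [CV] §§3–4 design calculus (adapted from the 2001 stockroom Lean leg). [folklore] -/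
lemma sumR3' (f : ℕ → ℝ) : ∑ i ∈ range (2 + 1), f i = f 0 + f 1 + f 2 := by
  rw [Finset.sum_range_succ, sumR2]

/-- Two-coordinate vector `(x₀, x₁, 0, 0, …)`. [folklore] -/
def vtwo (x₀ x₁ : ℝ) : ℕ → ℝ := fun i => if i = 0 then x₀ else if i = 1 then x₁ else 0

/-- Three-coordinate vector `(x₀, x₁, x₂, 0, …)`. [folklore] -/
def vthree (x₀ x₁ x₂ : ℝ) : ℕ → ℝ :=
  fun i => if i = 0 then x₀ else if i = 1 then x₁ else if i = 2 then x₂ else 0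

/-- Convenient `zpow` values of `√p`. [folklore] -/
lemma sqrt_zpow_neg_two (hp : p.Prime) :
    Real.sqrt (p:ℝ) ^ (-2 : ℤ) = ((Real.sqrt (p:ℝ))⁻¹) ^ 2 := by
  have hs0 : Real.sqrt (p:ℝ) ≠ 0 := by
    have : (0:ℝ) < p := by exact_mod_cast hp.pos
    positivity
  rw [show (-2:ℤ) = (-1) + (-1) by norm_num, zpow_add₀ hs0, zpow_neg_one]; ring

/-- Auxiliary step of the [CV] §§3–4 design calculus (adapted from the 2001 stockroom Lean leg). [folklore] -/
lemma sqrt_zpow_two (hp : p.Prime) : Real.sqrt (p:ℝ) ^ (2 : ℤ) = (p : ℝ) := by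
  have hs0 : (0:ℝ) ≤ (p:ℝ) := by positivity
  rw [show (2:ℤ) = (1:ℤ) + 1 by norm_num, zpow_add₀, zpow_one, Real.mul_self_sqrt hs0]
  have : (0:ℝ) < p := by exact_mod_cast hp.pos
  positivity

/-- Paper Lemma 3.3(i), evaluation off the multiples of `p`:
`φ_p[(x₀,x₁)](0) = x₀² + x₁² + 2x₀x₁/√p`. [folklore] -/
lemma locProfile_vtwo_of_not_dvd (_hp : p.Prime) (h : ¬ p ∣ n) (x₀ x₁ : ℝ) :
    locProfile p 1 (vtwo x₀ x₁) n
      = x₀ ^ 2 + x₁ ^ 2 + 2 * (x₀ * x₁) * (Real.sqrt (p : ℝ))⁻¹ := by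
  have hk : n.factorization p = 0 := Nat.factorization_eq_zero_of_not_dvd h
  unfold locProfile
  simp only [sumR2']
  rw [hk]
  have m1 : min (0 + 0) 0 = 0 := by omega
  have m2 : min (0 + 0) 1 = 0 := by omega
  have m3 : min (0 + 1) 0 = 0 := by omega
  have m4 : min (0 + 1) 1 = 1 := by omega
  rw [m1, m2, m3, m4]
  norm_num [vtwo, zpow_neg_one]
  ring

/-- Paper Lemma 3.3(i), evaluation on the multiples of `p`:
`φ_p[(x₀,x₁)](k) = x₀² + x₁² + x₀x₁(1/√p + √p)` for `k ≥ 1`. [folklore] -/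
lemma locProfile_vtwo_of_dvd (hp : p.Prime) (hn : n ≠ 0) (h : p ∣ n) (x₀ x₁ : ℝ) :
    locProfile p 1 (vtwo x₀ x₁) n
      = x₀ ^ 2 + x₁ ^ 2 + x₀ * x₁ * ((Real.sqrt (p : ℝ))⁻¹ + Real.sqrt (p : ℝ)) := by
  have hpos : 0 < n.factorization p := hp.factorization_pos_of_dvd hn h
  unfold locProfile
  simp only [sumR2']
  have m1 : min (n.factorization p + 0) 0 = 0 := by omega
  have m2 : min (n.factorization p + 0) 1 = 1 := by omega
  have m3 : min (n.factorization p + 1) 0 = 0 := by omega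
  have m4 : min (n.factorization p + 1) 1 = 1 := by omega
  rw [m1, m2, m3, m4]
  norm_num [vtwo, zpow_neg_one]
  ring

/-- Three-term evaluation at `v_p(n) = 0`. [folklore] -/
lemma locProfile_vthree_of_not_dvd (hp : p.Prime) (h : ¬ p ∣ n) (x₀ x₁ x₂ : ℝ) :
    locProfile p 2 (vthree x₀ x₁ x₂) n
      = x₀ ^ 2 + x₁ ^ 2 + x₂ ^ 2 + (2 * (x₀ * x₁) + 2 * (x₁ * x₂)) * (Real.sqrt (p : ℝ))⁻¹
        + 2 * (x₀ * x₂) * ((Real.sqrt (p : ℝ))⁻¹) ^ 2 := by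
  have hk : n.factorization p = 0 := Nat.factorization_eq_zero_of_not_dvd h
  unfold locProfile
  simp only [sumR3']
  rw [hk]
  have m00 : min (0 + 0) 0 = 0 := by omega
  have m01 : min (0 + 0) 1 = 0 := by omega
  have m02 : min (0 + 0) 2 = 0 := by omega
  have m10 : min (0 + 1) 0 = 0 := by omega
  have m11 : min (0 + 1) 1 = 1 := by omega
  have m12 : min (0 + 1) 2 = 1 := by omega
  have m20 : min (0 + 2) 0 = 0 := by omega
  have m21 : min (0 + 2) 1 = 1 := by omega
  have m22 : min (0 + 2) 2 = 2 := by omega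
  rw [m00, m01, m02, m10, m11, m12, m20, m21, m22]
  norm_num [vthree, zpow_neg_one, sqrt_zpow_neg_two hp]
  ring

/-- Three-term evaluation at `v_p(n) = 1`. [folklore] -/
lemma locProfile_vthree_of_dvd_not_sq (hp : p.Prime) (hn : n ≠ 0)
    (h1 : p ∣ n) (h2 : ¬ p ^ 2 ∣ n) (x₀ x₁ x₂ : ℝ) :
    locProfile p 2 (vthree x₀ x₁ x₂) n
      = x₀ ^ 2 + x₁ ^ 2 + x₂ ^ 2
        + (x₀ * x₁ + x₁ * x₂) * (Real.sqrt (p : ℝ) + (Real.sqrt (p : ℝ))⁻¹)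
        + x₀ * x₂ * (1 + ((Real.sqrt (p : ℝ))⁻¹) ^ 2) := by
  have hpos : 0 < n.factorization p := hp.factorization_pos_of_dvd hn h1
  have hlt : ¬ 2 ≤ n.factorization p := by
    intro hle
    exact h2 ((Nat.Prime.pow_dvd_iff_le_factorization hp hn).mpr hle)
  have hk : n.factorization p = 1 := by omega
  unfold locProfile
  simp only [sumR3']
  rw [hk]
  have m00 : min (1 + 0) 0 = 0 := by omega
  have m01 : min (1 + 0) 1 = 1 := by omega
  have m02 : min (1 + 0) 2 = 1 := by omega
  have m10 : min (1 + 1) 0 = 0 := by omega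
  have m11 : min (1 + 1) 1 = 1 := by omega
  have m12 : min (1 + 1) 2 = 2 := by omega
  have m20 : min (1 + 2) 0 = 0 := by omega
  have m21 : min (1 + 2) 1 = 1 := by omega
  have m22 : min (1 + 2) 2 = 2 := by omega
  rw [m00, m01, m02, m10, m11, m12, m20, m21, m22]
  norm_num [vthree, zpow_neg_one, sqrt_zpow_neg_two hp]
  ring

/-- Three-term evaluation at `v_p(n) ≥ 2`. [folklore] -/
lemma locProfile_vthree_of_sq_dvd (hp : p.Prime) (hn : n ≠ 0) (h : p ^ 2 ∣ n)
    (x₀ x₁ x₂ : ℝ) :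
    locProfile p 2 (vthree x₀ x₁ x₂) n
      = x₀ ^ 2 + x₁ ^ 2 + x₂ ^ 2
        + (x₀ * x₁ + x₁ * x₂) * (Real.sqrt (p : ℝ) + (Real.sqrt (p : ℝ))⁻¹)
        + x₀ * x₂ * ((p : ℝ) + ((Real.sqrt (p : ℝ))⁻¹) ^ 2) := by
  have h2 : 2 ≤ n.factorization p := (Nat.Prime.pow_dvd_iff_le_factorization hp hn).mp h
  unfold locProfile
  simp only [sumR3']
  have m00 : min (n.factorization p + 0) 0 = 0 := by omega
  have m01 : min (n.factorization p + 0) 1 = 1 := by omega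
  have m02 : min (n.factorization p + 0) 2 = 2 := by omega
  have m10 : min (n.factorization p + 1) 0 = 0 := by omega
  have m11 : min (n.factorization p + 1) 1 = 1 := by omega
  have m12 : min (n.factorization p + 1) 2 = 2 := by omega
  have m20 : min (n.factorization p + 2) 0 = 0 := by omega
  have m21 : min (n.factorization p + 2) 1 = 1 := by omega
  have m22 : min (n.factorization p + 2) 2 = 2 := by omega
  rw [m00, m01, m02, m10, m11, m12, m20, m21, m22]
  norm_num [vthree, zpow_neg_one, sqrt_zpow_neg_two hp, sqrt_zpow_two hp]
  ring

/-! ## Realization of every `τ ∈ I_p = [-(√p+1)/2, (√p-1)/2]` by a two-term factor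
(paper Lemma 3.3(i)).  Unnormalized form: the vector `(1, y)` has local profile
`a_p(y)·(1 + τ·1_{p∣n})` with `a_p(y) = 1 + y² + 2y/√p > 0`; the weight of the
design absorbs the constant `a_p(y)`. -/

/-- `N = (√p)⁻¹((p-1) - 2τ)`: the negated linear coefficient of the resonator
quadratic `τ y² - N y + τ = 0` (equivalent to `τ·a_p(y) = y(p-1)/√p`). [folklore] -/
def resN (p : ℕ) (τ : ℝ) : ℝ := (Real.sqrt (p:ℝ))⁻¹ * (((p:ℝ) - 1) - 2 * τ)

/-- Discriminant square root. [folklore] -/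
def resD (p : ℕ) (τ : ℝ) : ℝ := Real.sqrt ((resN p τ) ^ 2 - 4 * τ ^ 2)

/-- The explicit root `y = (N + √(N²-4τ²))/(2τ)`. [folklore] -/
def resY (p : ℕ) (τ : ℝ) : ℝ := (resN p τ + resD p τ) / (2 * τ)

/-- `a_p(y) = 1 + y² + 2y/√p`, evaluated at the root. [folklore] -/
def resA (p : ℕ) (τ : ℝ) : ℝ :=
  1 + (resY p τ) ^ 2 + 2 * resY p τ * (Real.sqrt (p:ℝ))⁻¹

/-- The (unnormalized) two-term design vector realizing `τ`. [folklore] -/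
def resVec (p : ℕ) (τ : ℝ) : ℕ → ℝ :=
  if τ = 0 then vtwo 1 0 else vtwo 1 (resY p τ)

/-- The constant multiple `resW = φ(0)` of the realized profile. [folklore] -/
def resW (p : ℕ) (τ : ℝ) : ℝ := if τ = 0 then 1 else resA p τ

/-- Auxiliary step of the [CV] §§3–4 design calculus (adapted from the 2001 stockroom Lean leg). [folklore] -/
lemma sqrt_prime_pos (hp : p.Prime) : 0 < Real.sqrt (p:ℝ) :=
  Real.sqrt_pos.mpr (by exact_mod_cast hp.pos)

/-- Auxiliary step of the [CV] §§3–4 design calculus (adapted from the 2001 stockroom Lean leg). [folklore] -/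
lemma one_lt_sqrt_prime (hp : p.Prime) : 1 < Real.sqrt (p:ℝ) := by
  have h2 : (2:ℝ) ≤ p := by exact_mod_cast hp.two_le
  calc (1:ℝ) = Real.sqrt 1 := Real.sqrt_one.symm
  _ < Real.sqrt (p:ℝ) := Real.sqrt_lt_sqrt (by norm_num) (by linarith)

/-- The discriminant identity `N² - 4τ² = (p-1)(p-(2τ+1)²)/p`. [folklore] -/
lemma resDisc_eq (hp : p.Prime) (τ : ℝ) :
    (resN p τ) ^ 2 - 4 * τ ^ 2 = ((p:ℝ) - 1) * ((p:ℝ) - (2*τ+1)^2) / (p:ℝ) := by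
  have hs0 : Real.sqrt (p:ℝ) ≠ 0 := (sqrt_prime_pos hp).ne'
  have hs2 : Real.sqrt (p:ℝ) * Real.sqrt (p:ℝ) = (p:ℝ) :=
    Real.mul_self_sqrt (by positivity)
  unfold resN
  set s := Real.sqrt (p:ℝ) with hs
  rw [← hs2]
  field_simp
  ring

/-- Auxiliary step of the [CV] §§3–4 design calculus (adapted from the 2001 stockroom Lean leg). [folklore] -/
lemma resDisc_nonneg (hp : p.Prime) {τ : ℝ}
    (hlo : -((Real.sqrt (p:ℝ) + 1)/2) ≤ τ) (hhi : τ ≤ (Real.sqrt (p:ℝ) - 1)/2) :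
    0 ≤ (resN p τ) ^ 2 - 4 * τ ^ 2 := by
  rw [resDisc_eq hp τ]
  have hp2 : (2:ℝ) ≤ p := by exact_mod_cast hp.two_le
  have hs2 : Real.sqrt (p:ℝ) ^ 2 = (p:ℝ) := Real.sq_sqrt (by positivity)
  apply div_nonneg _ (by positivity)
  apply mul_nonneg (by linarith)
  have habs : (2*τ+1)^2 ≤ Real.sqrt (p:ℝ) ^ 2 :=
    sq_le_sq' (by linarith) (by linarith)
  rw [hs2] at habs
  linarith

/-- Auxiliary step of the [CV] §§3–4 design calculus (adapted from the 2001 stockroom Lean leg). [folklore] -/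
lemma resD_sq (hp : p.Prime) {τ : ℝ}
    (hlo : -((Real.sqrt (p:ℝ) + 1)/2) ≤ τ) (hhi : τ ≤ (Real.sqrt (p:ℝ) - 1)/2) :
    (resD p τ) ^ 2 = (resN p τ) ^ 2 - 4 * τ ^ 2 :=
  Real.sq_sqrt (resDisc_nonneg hp hlo hhi)

/-- Auxiliary step of the [CV] §§3–4 design calculus (adapted from the 2001 stockroom Lean leg). [folklore] -/
lemma resD_nonneg (p : ℕ) (τ : ℝ) : 0 ≤ resD p τ := Real.sqrt_nonneg _

/-- `N > 0` throughout `I_p ∖ {0}` (both for `τ < 0` and for `0 < τ ≤ (√p-1)/2`,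
using in the second case that the discriminant is non-negative). [folklore] -/
lemma resN_pos (hp : p.Prime) {τ : ℝ} (hτ : τ ≠ 0)
    (hlo : -((Real.sqrt (p:ℝ) + 1)/2) ≤ τ) (hhi : τ ≤ (Real.sqrt (p:ℝ) - 1)/2) :
    0 < resN p τ := by
  have hp2 : (2:ℝ) ≤ p := by exact_mod_cast hp.two_le
  have hs1 : 1 < Real.sqrt (p:ℝ) := one_lt_sqrt_prime hp
  have hspos : 0 < Real.sqrt (p:ℝ) := sqrt_prime_pos hp
  have hdisc := resDisc_nonneg hp hlo hhi
  -- `N² ≥ 4τ² > 0`, so `N ≠ 0`; and `N ≥ 0` since `2τ ≤ √p - 1 ≤ p - 1`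
  have hτ2 : 0 < τ ^ 2 := by positivity
  have hN0 : resN p τ ≠ 0 := by
    intro h0
    rw [h0] at hdisc
    nlinarith
  have hsp : Real.sqrt (p:ℝ) ≤ (p:ℝ) := by
    nlinarith [Real.sq_sqrt (show (0:ℝ) ≤ (p:ℝ) by positivity)]
  have hNnn : 0 ≤ resN p τ := by
    unfold resN
    apply mul_nonneg (by positivity)
    linarith
  exact lt_of_le_of_ne hNnn (Ne.symm hN0)

/-- The resonator quadratic: `τ y² - N y + τ = 0` at the explicit root. [folklore] -/
lemma resY_quad (hp : p.Prime) {τ : ℝ} (hτ : τ ≠ 0)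
    (hlo : -((Real.sqrt (p:ℝ) + 1)/2) ≤ τ) (hhi : τ ≤ (Real.sqrt (p:ℝ) - 1)/2) :
    τ * (resY p τ) ^ 2 - resN p τ * resY p τ + τ = 0 := by
  have hD := resD_sq hp hlo hhi
  have h1 : 2 * τ * resY p τ = resN p τ + resD p τ := by
    unfold resY; field_simp
  have key : (2 * τ * resY p τ) ^ 2 - 2 * resN p τ * (2 * τ * resY p τ) + 4 * τ ^ 2 = 0 := by
    rw [h1]; linear_combination hD
  have h4 : 4 * τ * (τ * (resY p τ) ^ 2 - resN p τ * resY p τ + τ) = 0 := by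
    linear_combination key
  rcases mul_eq_zero.mp h4 with h | h
  · exact absurd h (by intro h'; exact hτ (by linarith))
  · exact h

/-- `a·τ = y·(p-1)/√p` (paper: `τ_p(y)·a_p(y) = y(p-1)/√p`). [folklore] -/
lemma resA_mul (hp : p.Prime) {τ : ℝ} (hτ : τ ≠ 0)
    (hlo : -((Real.sqrt (p:ℝ) + 1)/2) ≤ τ) (hhi : τ ≤ (Real.sqrt (p:ℝ) - 1)/2) :
    resA p τ * τ = resY p τ * (Real.sqrt (p:ℝ))⁻¹ * ((p:ℝ) - 1) := by
  have hq := resY_quad hp hτ hlo hhi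
  unfold resN at hq
  unfold resA
  linear_combination hq

/-- Auxiliary step of the [CV] §§3–4 design calculus (adapted from the 2001 stockroom Lean leg). [folklore] -/
lemma resY_neg_of_neg (hp : p.Prime) {τ : ℝ} (hτneg : τ < 0)
    (hlo : -((Real.sqrt (p:ℝ) + 1)/2) ≤ τ) (hhi : τ ≤ (Real.sqrt (p:ℝ) - 1)/2) :
    resY p τ < 0 := by
  have hN := resN_pos hp hτneg.ne hlo hhi
  have hD := resD_nonneg p τ
  unfold resY
  apply div_neg_of_pos_of_neg (by linarith)
  linarith

/-- Auxiliary step of the [CV] §§3–4 design calculus (adapted from the 2001 stockroom Lean leg). [folklore] -/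
lemma resY_pos_of_pos (hp : p.Prime) {τ : ℝ} (hτpos : 0 < τ)
    (hlo : -((Real.sqrt (p:ℝ) + 1)/2) ≤ τ) (hhi : τ ≤ (Real.sqrt (p:ℝ) - 1)/2) :
    0 < resY p τ := by
  have hN := resN_pos hp hτpos.ne' hlo hhi
  have hD := resD_nonneg p τ
  unfold resY
  apply div_pos (by linarith) (by linarith)

/-- Auxiliary step of the [CV] §§3–4 design calculus (adapted from the 2001 stockroom Lean leg). [folklore] -/
lemma resA_pos (hp : p.Prime) {τ : ℝ} (hτ : τ ≠ 0)
    (hlo : -((Real.sqrt (p:ℝ) + 1)/2) ≤ τ) (hhi : τ ≤ (Real.sqrt (p:ℝ) - 1)/2) :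
    0 < resA p τ := by
  have hAm := resA_mul hp hτ hlo hhi
  have hp2 : (2:ℝ) ≤ p := by exact_mod_cast hp.two_le
  have hspos : 0 < Real.sqrt (p:ℝ) := sqrt_prime_pos hp
  rcases lt_or_gt_of_ne hτ with hneg | hpos
  · have hy := resY_neg_of_neg hp hneg hlo hhi
    -- `a·τ = y·(√p)⁻¹·(p-1) < 0` and `τ < 0` force `a > 0`
    rcases lt_or_ge 0 (resA p τ) with hpos' | hle
    · exact hpos'
    · exfalso
      have h1 : 0 ≤ resA p τ * τ := by nlinarith
      have h2 : resY p τ * (Real.sqrt (p:ℝ))⁻¹ * ((p:ℝ) - 1) < 0 := by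
        apply mul_neg_of_neg_of_pos _ (by linarith)
        exact mul_neg_of_neg_of_pos hy (by positivity)
      rw [hAm] at h1
      linarith
  · have hy := resY_pos_of_pos hp hpos hlo hhi
    rcases lt_or_ge 0 (resA p τ) with hpos' | hle
    · exact hpos'
    · exfalso
      have h1 : resA p τ * τ ≤ 0 := by nlinarith
      have h2 : 0 < resY p τ * (Real.sqrt (p:ℝ))⁻¹ * ((p:ℝ) - 1) := by
        apply mul_pos _ (by linarith)
        exact mul_pos hy (by positivity)
      rw [hAm] at h1
      linarith

/-- Auxiliary step of the [CV] §§3–4 design calculus (adapted from the 2001 stockroom Lean leg). [folklore] -/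
lemma resW_pos (hp : p.Prime) {τ : ℝ}
    (hlo : -((Real.sqrt (p:ℝ) + 1)/2) ≤ τ) (hhi : τ ≤ (Real.sqrt (p:ℝ) - 1)/2) :
    0 < resW p τ := by
  unfold resW
  rcases eq_or_ne τ 0 with rfl | hτ
  · simp
  · rw [if_neg hτ]; exact resA_pos hp hτ hlo hhi

/-- THE REALIZATION (paper Lemma 3.3(i)): for every prime `p` and `τ ∈ I_p`, the
vector `resVec p τ` has local profile `resW·(1 + τ·1_{p∣n})` with `resW > 0`. [folklore] -/
lemma resVec_profile (hp : p.Prime) {τ : ℝ}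
    (hlo : -((Real.sqrt (p:ℝ) + 1)/2) ≤ τ) (hhi : τ ≤ (Real.sqrt (p:ℝ) - 1)/2)
    (n : ℕ) (hn : n ≠ 0) :
    locProfile p 1 (resVec p τ) n
      = resW p τ * (1 + τ * (if p ∣ n then 1 else 0)) := by
  have hs0 : Real.sqrt (p:ℝ) ≠ 0 := (sqrt_prime_pos hp).ne'
  rcases eq_or_ne τ 0 with rfl | hτ
  · unfold resVec resW
    rw [if_pos rfl, if_pos rfl]
    by_cases h : p ∣ n
    · rw [locProfile_vtwo_of_dvd hp hn h]; simp
    · rw [locProfile_vtwo_of_not_dvd hp h]; simp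
  · unfold resVec resW
    rw [if_neg hτ, if_neg hτ]
    by_cases h : p ∣ n
    · rw [locProfile_vtwo_of_dvd hp hn h, if_pos h]
      -- `1 + y² + y(1/√p + √p) = a(1 + τ)` from `a·τ = y·(√p)⁻¹·(p-1)`
      have hAm := resA_mul hp hτ hlo hhi
      have hp' : (p:ℝ) = Real.sqrt (p:ℝ) * Real.sqrt (p:ℝ) :=
        (Real.mul_self_sqrt (by positivity)).symm
      unfold resA at hAm ⊢
      set s := Real.sqrt (p:ℝ) with hs
      set y := resY p τ with hy
      rw [hp'] at hAm
      field_simp at hAm ⊢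
      linear_combination -hAm
    · rw [locProfile_vtwo_of_not_dvd hp h, if_neg h]
      unfold resA
      ring

/-- Three-term design vector (paper Lemma 3.3(ii)): `g_p = (1, -1/(2√p), 1)`,
unnormalized; profile `(2+1/(4p))·(1 + τ'_p·1_{p²∣n})`, `τ'_p = (p-1)/(2+1/(4p))`. [folklore] -/
def gVec (p : ℕ) : ℕ → ℝ := vthree 1 (-(Real.sqrt (p:ℝ))⁻¹ / 2) 1

/-- The three-term profile constant `2 + 1/(4p)`. [folklore] -/
def gW (p : ℕ) : ℝ := 2 + 1/(4*(p:ℝ))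

/-- The three-term boost `τ'_p = (p-1)/(2+1/(4p))`. [folklore] -/
def gTau (p : ℕ) : ℝ := ((p:ℝ) - 1) / (2 + 1/(4*(p:ℝ)))

/-- Auxiliary step of the [CV] §§3–4 design calculus (adapted from the 2001 stockroom Lean leg). [folklore] -/
lemma gW_pos (hp : p.Prime) : 0 < gW p := by
  have : (0:ℝ) < p := by exact_mod_cast hp.pos
  unfold gW; positivity

/-- Auxiliary step of the [CV] §§3–4 design calculus (adapted from the 2001 stockroom Lean leg). [folklore] -/
lemma gTau_nonneg (hp : p.Prime) : 0 ≤ gTau p := by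
  have hp2 : (2:ℝ) ≤ p := by exact_mod_cast hp.two_le
  have : (0:ℝ) < p := by linarith
  unfold gTau
  apply div_nonneg (by linarith) (by positivity)

/-- `τ'_p ≥ 8/17`, with equality at `p = 2` (paper (3.6)). [folklore] -/
lemma gTau_ge (hp : p.Prime) : 8/17 ≤ gTau p := by
  have hp2 : (2:ℝ) ≤ p := by exact_mod_cast hp.two_le
  have hppos : (0:ℝ) < p := by linarith
  have hX : (0:ℝ) < 2 + 1/(4*(p:ℝ)) := by positivity
  have hinv : 1/(p:ℝ) ≤ 1/2 := one_div_le_one_div_of_le (by norm_num) hp2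
  rw [gTau, le_div_iff₀ hX]
  have expand : (8:ℝ)/17 * (2 + 1/(4*(p:ℝ))) = 16/17 + (2/17) * (1/(p:ℝ)) := by
    field_simp; ring
  rw [expand]
  linarith

/-- Paper Lemma 3.3(ii): the three-term profile. [folklore] -/
lemma gVec_profile (hp : p.Prime) (n : ℕ) (hn : n ≠ 0) :
    locProfile p 2 (gVec p) n
      = gW p * (1 + gTau p * (if p ^ 2 ∣ n then 1 else 0)) := by
  have hs0 : Real.sqrt (p:ℝ) ≠ 0 := (sqrt_prime_pos hp).ne'
  have hp0 : (0:ℝ) < p := by exact_mod_cast hp.pos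
  have hp' : (p:ℝ) = Real.sqrt (p:ℝ) * Real.sqrt (p:ℝ) :=
    (Real.mul_self_sqrt (by positivity)).symm
  unfold gVec gW gTau
  by_cases h2 : p ^ 2 ∣ n
  · rw [locProfile_vthree_of_sq_dvd hp hn h2, if_pos h2]
    set s := Real.sqrt (p:ℝ) with hs
    rw [hp']
    field_simp
    ring
  · rw [if_neg h2, mul_zero, add_zero, mul_one]
    by_cases h1 : p ∣ n
    · rw [locProfile_vthree_of_dvd_not_sq hp hn h1 h2]
      set s := Real.sqrt (p:ℝ) with hs
      rw [hp']
      field_simp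
      ring
    · rw [locProfile_vthree_of_not_dvd hp h1]
      set s := Real.sqrt (p:ℝ) with hs
      rw [hp']
      field_simp
      ring

/-! ## Summability infrastructure -/

/-- Auxiliary step of the [CV] §§3–4 design calculus (adapted from the 2001 stockroom Lean leg). [folklore] -/
lemma cWeight_nonneg (H : TypeDesignHypotheses D c) (n : ℕ) : 0 ≤ cWeight c n := by
  unfold cWeight; split
  · exact div_nonneg (H.nonneg n) (Nat.cast_nonneg n)
  · exact le_rfl

/-- Master comparison: for a prime `p`, `Σ_{p∣n, n≥2} |z(n)| < ∞`
(combines the bundle's Lemma 2.3(ii) and Lemma 3.5). [folklore] -/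
lemma summable_dvd_abs (H : TypeDesignHypotheses D c) (hp : p.Prime) :
    Summable fun n : ℕ => if p ∣ n ∧ 2 ≤ n then |z c n| else 0 := by
  have hg1 : Summable fun n : ℕ => if ∃ k : ℕ, n = p ^ (k+1) then |z c n| else 0 := by
    have hinj : Function.Injective fun k : ℕ => p ^ (k + 1) := by
      intro a b hab
      simp only at hab
      have := Nat.pow_right_injective hp.two_le hab
      omega
    have h2 : Summable ((fun n : ℕ => if ∃ k : ℕ, n = p ^ (k+1) then |z c n| else 0)
        ∘ fun k : ℕ => p ^ (k + 1)) := by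
      have hcongr : ((fun n : ℕ => if ∃ k : ℕ, n = p ^ (k+1) then |z c n| else 0)
          ∘ fun k : ℕ => p ^ (k + 1)) = fun k : ℕ => |z c (p ^ (k+1))| := by
        funext k
        simp only [Function.comp_apply]
        exact if_pos ⟨k, rfl⟩
      rw [hcongr]
      exact H.summable_pp p hp
    refine (hinj.summable_iff ?_).mp h2
    intro x hx
    apply if_neg
    rintro ⟨k, hk⟩
    exact hx ⟨k, hk.symm⟩
  have habs0 : ∀ n : ℕ, (0:ℝ) ≤ (if ∃ k : ℕ, n = p ^ (k+1) then |z c n| else 0) := by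
    intro n; split
    · exact abs_nonneg _
    · exact le_rfl
  have hcw0 : ∀ n : ℕ, (0:ℝ) ≤ (if p ∣ n ∧ IsComposite n then c n / (n:ℝ) else 0) := by
    intro n; split
    · exact div_nonneg (H.nonneg n) (Nat.cast_nonneg n)
    · exact le_rfl
  have h0 : ∀ n : ℕ, (0:ℝ) ≤ (if p ∣ n ∧ 2 ≤ n then |z c n| else 0) := by
    intro n; split
    · exact abs_nonneg _
    · exact le_rfl
  refine Summable.of_nonneg_of_le h0 ?_ (hg1.add (H.summable_comp p hp))
  intro n
  by_cases hn : p ∣ n ∧ 2 ≤ n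
  · rw [if_pos hn]
    by_cases hpp : IsPrimePow n
    · have hex : ∃ k' : ℕ, n = p ^ (k'+1) := by
        obtain ⟨r, k, hr, hk, hrk⟩ := (isPrimePow_nat_iff n).mp hpp
        have hrn : r ∣ n := hrk ▸ dvd_pow_self r hk.ne'
        have hrp : r = p := prime_eq_of_dvd_isPrimePow hpp hr hp hrn hn.1
        refine ⟨k - 1, ?_⟩
        rw [← hrk, hrp]
        congr 1
        omega
      rw [if_pos hex]
      exact le_add_of_nonneg_right (hcw0 n)
    · have hcomp : IsComposite n := ⟨hn.2, hpp⟩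
      rw [if_pos (show p ∣ n ∧ IsComposite n from ⟨hn.1, hcomp⟩), z_eq_of_comp hcomp,
        abs_of_nonneg (div_nonneg (H.nonneg n) (Nat.cast_nonneg n))]
      apply le_add_of_nonneg_left
      split
      · exact div_nonneg (H.nonneg n) (Nat.cast_nonneg n)
      · exact le_rfl
  · rw [if_neg hn]
    exact add_nonneg (habs0 n) (hcw0 n)

/-- Workhorse: a function supported on `{n ≥ 2 : some p ∈ Q divides n}` and
dominated by `C·|z|` is summable. [folklore] -/
lemma summable_of_dvd_support (H : TypeDesignHypotheses D c) (Q : Finset ℕ)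
    (hQ : ∀ p ∈ Q, p.Prime) (ψ : ℕ → ℝ) (C : ℝ) (hC : 0 ≤ C)
    (hsupp : ∀ n, ψ n ≠ 0 → 2 ≤ n ∧ ∃ p ∈ Q, p ∣ n)
    (hle : ∀ n, |ψ n| ≤ C * |z c n|) : Summable ψ := by
  have hmaj : Summable fun n : ℕ =>
      C * ∑ p ∈ Q, (if p ∣ n ∧ 2 ≤ n then |z c n| else 0) := by
    apply Summable.mul_left
    apply summable_sum
    intro p hp
    exact summable_dvd_abs H (hQ p hp)
  have hterm0 : ∀ n : ℕ, ∀ q ∈ Q, (0:ℝ) ≤ (if q ∣ n ∧ 2 ≤ n then |z c n| else 0) := by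
    intro n q _; split
    · exact abs_nonneg _
    · exact le_rfl
  apply Summable.of_abs
  apply Summable.of_nonneg_of_le (fun n => abs_nonneg _) _ hmaj
  intro n
  rcases eq_or_ne (ψ n) 0 with h0 | h0
  · rw [h0, abs_zero]
    exact mul_nonneg hC (Finset.sum_nonneg (hterm0 n))
  · obtain ⟨hn2, p₀, hp₀Q, hp₀d⟩ := hsupp n h0
    calc |ψ n| ≤ C * |z c n| := hle n
    _ = C * (if p₀ ∣ n ∧ 2 ≤ n then |z c n| else 0) := by rw [if_pos ⟨hp₀d, hn2⟩]
    _ ≤ C * ∑ p ∈ Q, (if p ∣ n ∧ 2 ≤ n then |z c n| else 0) := by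
        apply mul_le_mul_of_nonneg_left _ hC
        exact Finset.single_le_sum
          (f := fun q => if q ∣ n ∧ 2 ≤ n then |z c n| else 0) (hterm0 n) hp₀Q

/-- Uniform bound on local profiles. [folklore] -/
lemma abs_locProfile_le (hp : p.Prime) (m : ℕ) (v : ℕ → ℝ) (n : ℕ) :
    |locProfile p m v n|
      ≤ (∑ i ∈ range (m+1), |v i|)^2 * Real.sqrt (p:ℝ) ^ (2*m) := by
  have hs1 : (1:ℝ) ≤ Real.sqrt (p:ℝ) := (one_lt_sqrt_prime hp).le
  have hs0 : (0:ℝ) < Real.sqrt (p:ℝ) := sqrt_prime_pos hp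
  have step1 : |locProfile p m v n|
      ≤ ∑ i ∈ range (m+1), ∑ j ∈ range (m+1), (|v i| * |v j| * Real.sqrt (p:ℝ) ^ (2*m)) := by
    refine (Finset.abs_sum_le_sum_abs _ _).trans ?_
    apply Finset.sum_le_sum
    intro i hi
    refine (Finset.abs_sum_le_sum_abs _ _).trans ?_
    apply Finset.sum_le_sum
    intro j hj
    rw [abs_mul, abs_mul, abs_zpow, abs_of_pos hs0]
    have he : Real.sqrt (p:ℝ)
          ^ (2 * ((min (n.factorization p + i) j : ℕ) : ℤ) - (i:ℤ) - (j:ℤ))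
        ≤ Real.sqrt (p:ℝ) ^ (2*m : ℕ) := by
      rw [← zpow_natCast (Real.sqrt (p:ℝ)) (2*m)]
      apply zpow_le_zpow_right₀ hs1
      have hjm : j ≤ m := Nat.lt_succ_iff.mp (Finset.mem_range.mp hj)
      have hmin : min (n.factorization p + i) j ≤ j := min_le_right _ _
      push_cast
      omega
    calc |v i| * |v j| * Real.sqrt (p:ℝ)
          ^ (2 * ((min (n.factorization p + i) j : ℕ) : ℤ) - (i:ℤ) - (j:ℤ))
        ≤ |v i| * |v j| * Real.sqrt (p:ℝ) ^ (2*m : ℕ) := by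
          apply mul_le_mul_of_nonneg_left he (mul_nonneg (abs_nonneg _) (abs_nonneg _))
    _ = |v i| * |v j| * Real.sqrt (p:ℝ) ^ (2*m) := rfl
  refine step1.trans_eq ?_
  rw [sq, Finset.sum_mul_sum]
  simp only [Finset.sum_mul]

/-- Local profiles depend on `n` only through `v_p(n)` (paper Lemma 3.2(a)). [folklore] -/
lemma locProfile_congr_fact {n' : ℕ} (h : n.factorization p = n'.factorization p)
    (m : ℕ) (v : ℕ → ℝ) : locProfile p m v n = locProfile p m v n' := by
  unfold locProfile
  refine Finset.sum_congr rfl fun i _ => Finset.sum_congr rfl fun j _ => ?_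
  rw [h]

/-- Master summability: `Σ_n z(n)(Φ(n) - Φ(1))` converges absolutely for every
two-component design profile. [folklore] -/
lemma summable_z_mul_profile_diff (H : TypeDesignHypotheses D c)
    (l₁ l₂ : ℝ) (P₁ P₂ : Finset ℕ) (m₁ m₂ : ℕ) (v₁ v₂ : ℕ → ℕ → ℝ)
    (hP₁ : ∀ p ∈ P₁, p.Prime) (hP₂ : ∀ p ∈ P₂, p.Prime) :
    Summable fun n : ℕ => z c n *
      (designProfile l₁ l₂ P₁ P₂ m₁ m₂ v₁ v₂ n - designProfile l₁ l₂ P₁ P₂ m₁ m₂ v₁ v₂ 1) := by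
  set M : ℝ := |l₁| * ∏ p ∈ P₁, ((∑ i ∈ range (m₁+1), |v₁ p i|)^2 * Real.sqrt (p:ℝ) ^ (2*m₁))
      + |l₂| * ∏ p ∈ P₂, ((∑ i ∈ range (m₂+1), |v₂ p i|)^2 * Real.sqrt (p:ℝ) ^ (2*m₂))
    with hMdef
  have hM0 : 0 ≤ M := by
    rw [hMdef]
    have h1 : ∀ p ∈ P₁, (0:ℝ) ≤ (∑ i ∈ range (m₁+1), |v₁ p i|)^2 * Real.sqrt (p:ℝ) ^ (2*m₁) :=
      fun p _ => by positivity
    have h2 : ∀ p ∈ P₂, (0:ℝ) ≤ (∑ i ∈ range (m₂+1), |v₂ p i|)^2 * Real.sqrt (p:ℝ) ^ (2*m₂) :=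
      fun p _ => by positivity
    have := Finset.prod_nonneg h1
    have := Finset.prod_nonneg h2
    positivity
  have hMbound : ∀ n, |designProfile l₁ l₂ P₁ P₂ m₁ m₂ v₁ v₂ n| ≤ M := by
    intro n
    unfold designProfile
    refine (abs_add_le _ _).trans ?_
    rw [hMdef]
    apply add_le_add
    · rw [abs_mul, Finset.abs_prod]
      apply mul_le_mul_of_nonneg_left _ (abs_nonneg l₁)
      exact Finset.prod_le_prod (fun p _ => abs_nonneg _)
        (fun p hp' => abs_locProfile_le (hP₁ p hp') m₁ (v₁ p) n)
    · rw [abs_mul, Finset.abs_prod]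
      apply mul_le_mul_of_nonneg_left _ (abs_nonneg l₂)
      exact Finset.prod_le_prod (fun p _ => abs_nonneg _)
        (fun p hp' => abs_locProfile_le (hP₂ p hp') m₂ (v₂ p) n)
  apply summable_of_dvd_support H (P₁ ∪ P₂)
    (fun p hp' => (Finset.mem_union.mp hp').elim (hP₁ p) (hP₂ p)) _ (2*M) (by linarith)
  · -- support: `Φ(n) = Φ(1)` unless some design prime divides `n ≥ 2`
    intro n hn
    constructor
    · by_contra hlt
      have hn2 : n < 2 := by omega
      interval_cases n
      · exact hn (by rw [z_zero, zero_mul])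
      · exact hn (by rw [sub_self, mul_zero])
    · by_contra hnone
      apply hn
      have hfa : ∀ p ∈ P₁ ∪ P₂, n.factorization p = (1:ℕ).factorization p := by
        intro p hp'
        have hnd : ¬ p ∣ n := fun hd => hnone ⟨p, hp', hd⟩
        rw [Nat.factorization_eq_zero_of_not_dvd hnd, Nat.factorization_one]
        simp
      have hΦ : designProfile l₁ l₂ P₁ P₂ m₁ m₂ v₁ v₂ n
          = designProfile l₁ l₂ P₁ P₂ m₁ m₂ v₁ v₂ 1 := by
        unfold designProfile
        congr 1
        · congr 1
          exact Finset.prod_congr rfl fun p hp' =>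
            locProfile_congr_fact (hfa p (Finset.mem_union_left _ hp')) m₁ (v₁ p)
        · congr 1
          exact Finset.prod_congr rfl fun p hp' =>
            locProfile_congr_fact (hfa p (Finset.mem_union_right _ hp')) m₂ (v₂ p)
      rw [hΦ, sub_self, mul_zero]
  · intro n
    rw [abs_mul]
    have hdiff : |designProfile l₁ l₂ P₁ P₂ m₁ m₂ v₁ v₂ n
        - designProfile l₁ l₂ P₁ P₂ m₁ m₂ v₁ v₂ 1| ≤ 2*M := by
      calc |designProfile l₁ l₂ P₁ P₂ m₁ m₂ v₁ v₂ n
          - designProfile l₁ l₂ P₁ P₂ m₁ m₂ v₁ v₂ 1|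
          = |designProfile l₁ l₂ P₁ P₂ m₁ m₂ v₁ v₂ n
            + -(designProfile l₁ l₂ P₁ P₂ m₁ m₂ v₁ v₂ 1)| := by rw [sub_eq_add_neg]
        _ ≤ |designProfile l₁ l₂ P₁ P₂ m₁ m₂ v₁ v₂ n|
            + |-(designProfile l₁ l₂ P₁ P₂ m₁ m₂ v₁ v₂ 1)| := abs_add_le _ _
        _ ≤ M + M := by
            rw [abs_neg]
            exact add_le_add (hMbound n) (hMbound 1)
        _ = 2*M := by ring
    calc |z c n| * |designProfile l₁ l₂ P₁ P₂ m₁ m₂ v₁ v₂ n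
        - designProfile l₁ l₂ P₁ P₂ m₁ m₂ v₁ v₂ 1|
        ≤ |z c n| * (2*M) := mul_le_mul_of_nonneg_left hdiff (abs_nonneg _)
      _ = 2*M * |z c n| := mul_comm _ _

/-- Prime-power regrouping: a summable function supported on `{p^k : p ∈ P, k ≥ 1}`
sums as `Σ_{p∈P} Σ_k`. [folklore] -/
lemma tsum_primePow_group :
    ∀ (P : Finset ℕ), (∀ p ∈ P, p.Prime) → ∀ f : ℕ → ℝ, Summable f →
      (∀ n, f n ≠ 0 → ∃ p ∈ P, ∃ k : ℕ, n = p ^ (k+1)) →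
      ∑' n, f n = ∑ p ∈ P, ∑' k, f (p ^ (k+1)) := by
  intro P
  induction P using Finset.induction_on with
  | empty =>
    intro _ f _ hsupp
    have hf0 : f = fun _ => 0 := by
      funext n
      by_contra h0
      obtain ⟨p, hp, _⟩ := hsupp n h0
      exact absurd hp (Finset.notMem_empty p)
    rw [hf0]
    simp
  | insert q Q hqQ ih =>
    intro hP f hf hsupp
    have hqP : q.Prime := hP q (Finset.mem_insert_self q Q)
    set f₁ : ℕ → ℝ := fun n => if ∃ k : ℕ, n = q ^ (k+1) then f n else 0 with hf₁def
    set f₂ : ℕ → ℝ := fun n => if ∃ k : ℕ, n = q ^ (k+1) then 0 else f n with hf₂def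
    have hsplit : ∀ n, f n = f₁ n + f₂ n := by
      intro n
      simp only [hf₁def, hf₂def]
      split <;> ring
    have habs : Summable fun n => |f n| := hf.abs
    have hs₁ : Summable f₁ := by
      apply Summable.of_abs
      apply Summable.of_nonneg_of_le (fun n => abs_nonneg _) _ habs
      intro n
      simp only [hf₁def]
      split
      · exact le_rfl
      · simp
    have hs₂ : Summable f₂ := by
      apply Summable.of_abs
      apply Summable.of_nonneg_of_le (fun n => abs_nonneg _) _ habs
      intro n
      simp only [hf₂def]
      split
      · simp
      · exact le_rfl
    have htsum : ∑' n, f n = ∑' n, f₁ n + ∑' n, f₂ n := by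
      rw [← hs₁.tsum_add hs₂]
      exact tsum_congr hsplit
    have h₁ : ∑' n, f₁ n = ∑' k, f (q ^ (k+1)) := by
      have hinj : Function.Injective fun k : ℕ => q ^ (k + 1) := by
        intro a b hab
        simp only at hab
        have := Nat.pow_right_injective hqP.two_le hab
        omega
      have hsub : Function.support f₁ ⊆ Set.range fun k : ℕ => q ^ (k + 1) := by
        intro x hx
        by_contra hmem
        apply hx
        simp only [hf₁def]
        apply if_neg
        rintro ⟨k, hk⟩
        exact hmem ⟨k, hk.symm⟩
      have heq := hinj.tsum_eq (f := f₁) hsub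
      rw [← heq]
      apply tsum_congr
      intro k
      simp only [hf₁def]
      exact if_pos ⟨k, rfl⟩
    have h₂ : ∑' n, f₂ n = ∑ p ∈ Q, ∑' k, f₂ (p ^ (k+1)) := by
      apply ih (fun p hp => hP p (Finset.mem_insert_of_mem hp)) f₂ hs₂
      intro n hn
      simp only [hf₂def] at hn
      by_cases hq' : ∃ k : ℕ, n = q ^ (k+1)
      · rw [if_pos hq'] at hn
        exact absurd rfl hn
      · rw [if_neg hq'] at hn
        obtain ⟨p, hpmem, k, hk⟩ := hsupp n hn
        rcases Finset.mem_insert.mp hpmem with rfl | hpQ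
        · exact absurd ⟨k, hk⟩ hq'
        · exact ⟨p, hpQ, k, hk⟩
    have h₃ : ∀ p ∈ Q, ∑' k, f₂ (p ^ (k+1)) = ∑' k, f (p ^ (k+1)) := by
      intro p hpQ
      apply tsum_congr
      intro k
      simp only [hf₂def]
      apply if_neg
      rintro ⟨k', hk'⟩
      have hpP : p.Prime := hP p (Finset.mem_insert_of_mem hpQ)
      have hpq : p = q := by
        have hdvd : p ∣ q ^ (k'+1) := hk' ▸ dvd_pow_self p (Nat.succ_ne_zero k)
        exact (Nat.prime_dvd_prime_iff_eq hpP hqP).mp (hpP.dvd_of_dvd_pow hdvd)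
      subst hpq
      exact hqQ hpQ
    rw [htsum, h₁, h₂, Finset.sum_insert hqQ]
    congr 1
    exact Finset.sum_congr rfl h₃

/-! ## `D_p`, `T₁(p)`, geometric tails, and the classical log-majorant -/

/-- `D_p = Σ_{k≥1} z(p^k)` (paper §4). [folklore] -/
def Dp (c : ℕ → ℝ) (p : ℕ) : ℝ := ∑' k : ℕ, z c (p ^ (k+1))

/-- `T₁(p) = Σ_{k≥2} z(p^k)` (paper §4). [folklore] -/
def T1p (c : ℕ → ℝ) (p : ℕ) : ℝ := ∑' k : ℕ, z c (p ^ (k+2))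

/-- Auxiliary step of the [CV] §§3–4 design calculus (adapted from the 2001 stockroom Lean leg). [folklore] -/
lemma summable_z_pp (H : TypeDesignHypotheses D c) (hp : p.Prime) :
    Summable fun k : ℕ => z c (p ^ (k+1)) := (H.summable_pp p hp).of_abs

/-- Auxiliary step of the [CV] §§3–4 design calculus (adapted from the 2001 stockroom Lean leg). [folklore] -/
lemma summable_z_pp2 (H : TypeDesignHypotheses D c) (hp : p.Prime) :
    Summable fun k : ℕ => z c (p ^ (k+2)) := by
  have h2 : Summable fun k : ℕ => z c (p ^ ((k+1)+1)) :=
    (summable_nat_add_iff 1).mpr (summable_z_pp H hp)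
  exact h2

/-- Auxiliary step of the [CV] §§3–4 design calculus (adapted from the 2001 stockroom Lean leg). [folklore] -/
lemma summable_abs_z_pp2 (H : TypeDesignHypotheses D c) (hp : p.Prime) :
    Summable fun k : ℕ => |z c (p ^ (k+2))| := by
  have h2 : Summable fun k : ℕ => |z c (p ^ ((k+1)+1))| :=
    (summable_nat_add_iff 1).mpr (H.summable_pp p hp)
  exact h2

/-- Auxiliary step of the [CV] §§3–4 design calculus (adapted from the 2001 stockroom Lean leg). [folklore] -/
lemma Dp_eq_z_add_T1p (H : TypeDesignHypotheses D c) (hp : p.Prime) :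
    Dp c p = z c p + T1p c p := by
  unfold Dp T1p
  rw [tsum_eq_zero_add' ((summable_nat_add_iff 1).mpr (summable_z_pp H hp))]
  congr 1
  norm_num

/-- Geometric tail: `Σ_{k≥0} p^{-(k+2)} = 1/(p(p-1))`. [folklore] -/
lemma tsum_geo_pp (hp : p.Prime) :
    ∑' k : ℕ, ((p:ℝ)⁻¹) ^ (k+2) = ((p:ℝ) * ((p:ℝ) - 1))⁻¹ := by
  have hp2 : (2:ℝ) ≤ p := by exact_mod_cast hp.two_le
  have hppos : (0:ℝ) < p := by linarith
  have hpne : (p:ℝ) ≠ 0 := hppos.ne'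
  have hpne1 : (p:ℝ) - 1 ≠ 0 := by intro h; nlinarith
  have h0 : (0:ℝ) ≤ (p:ℝ)⁻¹ := by positivity
  have h1 : (p:ℝ)⁻¹ < 1 := by
    rw [inv_lt_one₀ hppos]
    linarith
  have hgeo := tsum_geometric_of_lt_one h0 h1
  calc ∑' k : ℕ, ((p:ℝ)⁻¹) ^ (k+2) = ∑' k : ℕ, ((p:ℝ)⁻¹) ^ k * ((p:ℝ)⁻¹) ^ 2 := by
        apply tsum_congr
        intro k
        rw [pow_add]
    _ = (∑' k : ℕ, ((p:ℝ)⁻¹) ^ k) * ((p:ℝ)⁻¹) ^ 2 := tsum_mul_right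
    _ = (1 - (p:ℝ)⁻¹)⁻¹ * ((p:ℝ)⁻¹) ^ 2 := by rw [hgeo]
    _ = ((p:ℝ) * ((p:ℝ) - 1))⁻¹ := by
        have hne : 1 - (p:ℝ)⁻¹ ≠ 0 := by
          have : (p:ℝ)⁻¹ < 1 := h1
          intro h
          rw [sub_eq_zero] at h
          rw [← h] at this
          exact lt_irrefl _ this
        field_simp

/-- Absolute tail bound: `Σ_{k≥2}|z(p^k)| ≤ T₁(p) + 2 log p/(p(p-1))`. [folklore] -/
lemma tsum_abs_tail_le (H : TypeDesignHypotheses D c) (hp : p.Prime) :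
    ∑' k : ℕ, |z c (p ^ (k+2))|
      ≤ T1p c p + 2 * (Real.log p * ((p:ℝ) * ((p:ℝ) - 1))⁻¹) := by
  have hp2 : (2:ℝ) ≤ p := by exact_mod_cast hp.two_le
  have hlog0 : 0 ≤ Real.log p := Real.log_nonneg (by linarith)
  have hΛ : ∀ k : ℕ, Λ (p ^ (k+2)) / ((p ^ (k+2) : ℕ):ℝ)
      = Real.log p * ((p:ℝ)⁻¹) ^ (k+2) := by
    intro k
    rw [show k + 2 = (k+1) + 1 from rfl, vonMangoldt_prime_pow hp]
    push_cast
    rw [div_eq_mul_inv, inv_pow]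
  have h1 : ∀ k : ℕ, |z c (p ^ (k+2))|
      ≤ z c (p ^ (k+2)) + 2 * (Real.log p * ((p:ℝ)⁻¹) ^ (k+2)) := by
    intro k
    have hneg := neg_z_le H.nonneg (p ^ (k+2))
    rw [hΛ k] at hneg
    have hterm0 : 0 ≤ Real.log p * ((p:ℝ)⁻¹) ^ (k+2) := by positivity
    rcases abs_cases (z c (p ^ (k+2))) with ⟨he, _⟩ | ⟨he, _⟩
    · rw [he]; linarith
    · rw [he]; linarith
  have hb : Summable fun k : ℕ => 2 * (Real.log p * ((p:ℝ)⁻¹) ^ (k+2)) := by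
    apply Summable.mul_left
    apply Summable.mul_left
    have hgeo : Summable fun k : ℕ => ((p:ℝ)⁻¹) ^ k := by
      apply summable_geometric_of_lt_one (by positivity)
      rw [inv_lt_one₀ (by exact_mod_cast hp.pos)]
      exact_mod_cast hp.one_lt
    exact (summable_nat_add_iff 2).mpr hgeo
  have hsum2 : Summable fun k : ℕ =>
      z c (p ^ (k+2)) + 2 * (Real.log p * ((p:ℝ)⁻¹) ^ (k+2)) :=
    (summable_z_pp2 H hp).add hb
  calc ∑' k : ℕ, |z c (p ^ (k+2))|
      ≤ ∑' k : ℕ, (z c (p ^ (k+2)) + 2 * (Real.log p * ((p:ℝ)⁻¹) ^ (k+2))) :=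
        Summable.tsum_le_tsum h1 (summable_abs_z_pp2 H hp) hsum2
    _ = (∑' k : ℕ, z c (p ^ (k+2))) + ∑' k : ℕ, 2 * (Real.log p * ((p:ℝ)⁻¹) ^ (k+2)) :=
        (summable_z_pp2 H hp).tsum_add hb
    _ = T1p c p + 2 * (Real.log p * ∑' k : ℕ, ((p:ℝ)⁻¹) ^ (k+2)) := by
        rw [tsum_mul_left, tsum_mul_left]
        rfl
    _ = T1p c p + 2 * (Real.log p * ((p:ℝ) * ((p:ℝ) - 1))⁻¹) := by
        rw [tsum_geo_pp hp]

/-- The classical majorant `Σ_m log m/(m(m-1)) < ∞`. [folklore] -/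
def logMaj (m : ℕ) : ℝ := if 2 ≤ m then Real.log m / ((m:ℝ) * ((m:ℝ) - 1)) else 0

/-- Auxiliary step of the [CV] §§3–4 design calculus (adapted from the 2001 stockroom Lean leg). [folklore] -/
lemma logMaj_nonneg (m : ℕ) : 0 ≤ logMaj m := by
  unfold logMaj
  split
  · rename_i h
    have h2 : (2:ℝ) ≤ m := by exact_mod_cast h
    apply div_nonneg (Real.log_nonneg (by linarith)) (by nlinarith)
  · exact le_rfl

/-- Auxiliary step of the [CV] §§3–4 design calculus (adapted from the 2001 stockroom Lean leg). [folklore] -/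
lemma logMaj_prime (hp : p.Prime) :
    logMaj p = Real.log p * ((p:ℝ) * ((p:ℝ) - 1))⁻¹ := by
  unfold logMaj
  rw [if_pos hp.two_le, div_eq_mul_inv]

/-- Auxiliary step of the [CV] §§3–4 design calculus (adapted from the 2001 stockroom Lean leg). [folklore] -/
lemma summable_logMaj : Summable logMaj := by
  have hmaj : Summable fun m : ℕ => 4 * (1/(m:ℝ) ^ ((3:ℝ)/2)) := by
    apply Summable.mul_left
    exact Real.summable_one_div_nat_rpow.mpr (by norm_num)
  apply Summable.of_nonneg_of_le logMaj_nonneg _ hmaj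
  · intro m
    unfold logMaj
    split
    · rename_i h
      have h2 : (2:ℝ) ≤ m := by exact_mod_cast h
      have hm0 : (0:ℝ) < m := by linarith
      have hs0 : (0:ℝ) < Real.sqrt m := Real.sqrt_pos.mpr hm0
      have hss : Real.sqrt (m:ℝ) * Real.sqrt (m:ℝ) = (m:ℝ) :=
        Real.mul_self_sqrt hm0.le
      have hlog : Real.log m ≤ 2 * Real.sqrt m := by
        have h1 : Real.log (Real.sqrt (m:ℝ)) = Real.log (m:ℝ) / 2 :=
          Real.log_sqrt hm0.le
        have h2' := Real.log_le_sub_one_of_pos hs0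
        linarith
      have hrpow : (m:ℝ) ^ ((3:ℝ)/2) = (m:ℝ) * Real.sqrt m := by
        rw [show ((3:ℝ)/2) = 1 + 1/2 by norm_num, Real.rpow_add hm0, Real.rpow_one,
          Real.sqrt_eq_rpow]
      rw [hrpow, mul_one_div, div_le_div_iff₀ (by nlinarith) (by positivity)]
      have hkey : Real.log m * ((m:ℝ) * Real.sqrt m) ≤ 2 * (m:ℝ) * (m:ℝ) := by
        calc Real.log m * ((m:ℝ) * Real.sqrt m)
            ≤ (2 * Real.sqrt m) * ((m:ℝ) * Real.sqrt m) :=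
              mul_le_mul_of_nonneg_right hlog (by positivity)
          _ = 2 * (m:ℝ) * (Real.sqrt m * Real.sqrt m) := by ring
          _ = 2 * (m:ℝ) * (m:ℝ) := by rw [hss]
      nlinarith [hkey, mul_nonneg (show (0:ℝ) ≤ (m:ℝ) by linarith)
        (show (0:ℝ) ≤ (m:ℝ) - 2 by linarith)]
    · positivity

/-! ## The design engine -/

/-- `Φ(n) = ∏_{p ∈ P, p ∣ n} (1 + τ_p)`: the profile of a product of realized
two-term factors (paper Lemma 3.2(b) + Lemma 3.3(i)). [folklore] -/
def prodPhi (P : Finset ℕ) (τf : ℕ → ℝ) (n : ℕ) : ℝ :=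
  ∏ p ∈ P.filter (· ∣ n), (1 + τf p)

/-- `Φ'(n) = ∏_{p ∈ P, p² ∣ n} (1 + τ'_p)`: the three-term analogue. [folklore] -/
def prodPhi2 (Q : Finset ℕ) (n : ℕ) : ℝ :=
  ∏ p ∈ Q.filter (fun p => p ^ 2 ∣ n), (1 + gTau p)

/-- Auxiliary step of the [CV] §§3–4 design calculus (adapted from the 2001 stockroom Lean leg). [folklore] -/
lemma prod_resVec (P : Finset ℕ) (hP : ∀ p ∈ P, p.Prime) (τf : ℕ → ℝ)
    (hτ : ∀ p ∈ P, -((Real.sqrt (p:ℝ) + 1)/2) ≤ τf p ∧ τf p ≤ (Real.sqrt (p:ℝ) - 1)/2)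
    (n : ℕ) (hn : n ≠ 0) :
    ∏ p ∈ P, locProfile p 1 (resVec p (τf p)) n
      = (∏ p ∈ P, resW p (τf p)) * prodPhi P τf n := by
  unfold prodPhi
  calc ∏ p ∈ P, locProfile p 1 (resVec p (τf p)) n
      = ∏ p ∈ P, (resW p (τf p) * (1 + τf p * (if p ∣ n then 1 else 0))) :=
        Finset.prod_congr rfl fun p hp' =>
          resVec_profile (hP p hp') (hτ p hp').1 (hτ p hp').2 n hn
    _ = (∏ p ∈ P, resW p (τf p)) * ∏ p ∈ P, (1 + τf p * (if p ∣ n then 1 else 0)) :=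
        Finset.prod_mul_distrib
    _ = (∏ p ∈ P, resW p (τf p)) * ∏ p ∈ P.filter (· ∣ n), (1 + τf p) := by
        congr 1
        rw [← Finset.prod_filter_mul_prod_filter_not P (· ∣ n)]
        have h1 : ∏ p ∈ P.filter (· ∣ n), (1 + τf p * (if p ∣ n then 1 else 0))
            = ∏ p ∈ P.filter (· ∣ n), (1 + τf p) := by
          refine Finset.prod_congr rfl fun p hp' => ?_
          rw [if_pos (Finset.mem_filter.mp hp').2, mul_one]
        have h2 : ∏ p ∈ P.filter (fun p => ¬ p ∣ n), (1 + τf p * (if p ∣ n then 1 else 0))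
            = 1 := by
          refine Finset.prod_eq_one fun p hp' => ?_
          rw [if_neg (Finset.mem_filter.mp hp').2, mul_zero, add_zero]
        rw [h1, h2, mul_one]

/-- Auxiliary step of the [CV] §§3–4 design calculus (adapted from the 2001 stockroom Lean leg). [folklore] -/
lemma prod_gVec (Q : Finset ℕ) (hQ : ∀ p ∈ Q, p.Prime) (n : ℕ) (hn : n ≠ 0) :
    ∏ p ∈ Q, locProfile p 2 (gVec p) n = (∏ p ∈ Q, gW p) * prodPhi2 Q n := by
  unfold prodPhi2
  calc ∏ p ∈ Q, locProfile p 2 (gVec p) n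
      = ∏ p ∈ Q, (gW p * (1 + gTau p * (if p ^ 2 ∣ n then 1 else 0))) :=
        Finset.prod_congr rfl fun p hp' => gVec_profile (hQ p hp') n hn
    _ = (∏ p ∈ Q, gW p) * ∏ p ∈ Q, (1 + gTau p * (if p ^ 2 ∣ n then 1 else 0)) :=
        Finset.prod_mul_distrib
    _ = (∏ p ∈ Q, gW p) * ∏ p ∈ Q.filter (fun p => p ^ 2 ∣ n), (1 + gTau p) := by
        congr 1
        rw [← Finset.prod_filter_mul_prod_filter_not Q (fun p => p ^ 2 ∣ n)]
        have h1 : ∏ p ∈ Q.filter (fun p => p ^ 2 ∣ n), (1 + gTau p * (if p ^ 2 ∣ n then 1 else 0))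
            = ∏ p ∈ Q.filter (fun p => p ^ 2 ∣ n), (1 + gTau p) := by
          refine Finset.prod_congr rfl fun p hp' => ?_
          rw [if_pos (Finset.mem_filter.mp hp').2, mul_one]
        have h2 : ∏ p ∈ Q.filter (fun p => ¬ p ^ 2 ∣ n), (1 + gTau p * (if p ^ 2 ∣ n then 1 else 0))
            = 1 := by
          refine Finset.prod_eq_one fun p hp' => ?_
          rw [if_neg (Finset.mem_filter.mp hp').2, mul_zero, add_zero]
        rw [h1, h2, mul_one]

/-- Auxiliary step of the [CV] §§3–4 design calculus (adapted from the 2001 stockroom Lean leg). [folklore] -/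
lemma filter_dvd_one_eq_empty (P : Finset ℕ) (hP : ∀ p ∈ P, p.Prime) :
    P.filter (· ∣ 1) = ∅ := by
  rw [Finset.filter_eq_empty_iff]
  intro p hp' hdvd
  exact (hP p hp').one_lt.ne' (Nat.dvd_one.mp hdvd)

/-- Auxiliary step of the [CV] §§3–4 design calculus (adapted from the 2001 stockroom Lean leg). [folklore] -/
lemma filter_sq_dvd_one_eq_empty (Q : Finset ℕ) (hQ : ∀ p ∈ Q, p.Prime) :
    Q.filter (fun p => p ^ 2 ∣ 1) = ∅ := by
  rw [Finset.filter_eq_empty_iff]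
  intro p hp' hdvd
  have : p ∣ 1 := dvd_trans (dvd_pow_self p two_ne_zero) hdvd
  exact (hQ p hp').one_lt.ne' (Nat.dvd_one.mp this)

/-- Auxiliary step of the [CV] §§3–4 design calculus (adapted from the 2001 stockroom Lean leg). [folklore] -/
lemma prodPhi_one (P : Finset ℕ) (hP : ∀ p ∈ P, p.Prime) (τf : ℕ → ℝ) :
    prodPhi P τf 1 = 1 := by
  unfold prodPhi
  rw [filter_dvd_one_eq_empty P hP, Finset.prod_empty]

/-- Auxiliary step of the [CV] §§3–4 design calculus (adapted from the 2001 stockroom Lean leg). [folklore] -/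
lemma prodPhi2_one (Q : Finset ℕ) (hQ : ∀ p ∈ Q, p.Prime) : prodPhi2 Q 1 = 1 := by
  unfold prodPhi2
  rw [filter_sq_dvd_one_eq_empty Q hQ, Finset.prod_empty]

/-- THE ENGINE: the type inequality for a mixture of two realized product
resonators (with the profile-constants folded into the weights). [folklore] -/
lemma two_design (H : TypeDesignHypotheses D c) (P : Finset ℕ) (hP : ∀ p ∈ P, p.Prime)
    (τ₁ τ₂ : ℕ → ℝ)
    (hr₁ : ∀ p ∈ P, -((Real.sqrt (p:ℝ) + 1)/2) ≤ τ₁ p ∧ τ₁ p ≤ (Real.sqrt (p:ℝ) - 1)/2)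
    (hr₂ : ∀ p ∈ P, -((Real.sqrt (p:ℝ) + 1)/2) ≤ τ₂ p ∧ τ₂ p ≤ (Real.sqrt (p:ℝ) - 1)/2)
    (w₁ w₂ : ℝ) (hw₁ : 0 < w₁) (hw₂ : 0 < w₂) :
    Summable (fun n : ℕ => z c n *
      (w₁ * prodPhi P τ₁ n + w₂ * prodPhi P τ₂ n - (w₁ + w₂))) ∧
    (w₁ + w₂) * H.C₁ + ∑' n : ℕ, z c n *
      (w₁ * prodPhi P τ₁ n + w₂ * prodPhi P τ₂ n - (w₁ + w₂)) ≤ D * (w₁ + w₂) := by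
  classical
  set W₁ : ℝ := ∏ p ∈ P, resW p (τ₁ p) with hW₁def
  set W₂ : ℝ := ∏ p ∈ P, resW p (τ₂ p) with hW₂def
  have hW₁pos : 0 < W₁ := by
    rw [hW₁def]
    exact Finset.prod_pos fun p hp' => resW_pos (hP p hp') (hr₁ p hp').1 (hr₁ p hp').2
  have hW₂pos : 0 < W₂ := by
    rw [hW₂def]
    exact Finset.prod_pos fun p hp' => resW_pos (hP p hp') (hr₂ p hp').1 (hr₂ p hp').2
  have hW₁ne : W₁ ≠ 0 := hW₁pos.ne'
  have hW₂ne : W₂ ≠ 0 := hW₂pos.ne'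
  have hΦ : ∀ n : ℕ, n ≠ 0 →
      designProfile (w₁/W₁) (w₂/W₂) P P 1 1
        (fun p => resVec p (τ₁ p)) (fun p => resVec p (τ₂ p)) n
        = w₁ * prodPhi P τ₁ n + w₂ * prodPhi P τ₂ n := by
    intro n hn
    simp only [designProfile]
    rw [prod_resVec P hP τ₁ hr₁ n hn, prod_resVec P hP τ₂ hr₂ n hn, ← hW₁def, ← hW₂def]
    field_simp
  have hΦ1 : designProfile (w₁/W₁) (w₂/W₂) P P 1 1
      (fun p => resVec p (τ₁ p)) (fun p => resVec p (τ₂ p)) 1 = w₁ + w₂ := by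
    rw [hΦ 1 one_ne_zero, prodPhi_one P hP, prodPhi_one P hP, mul_one, mul_one]
  have hcongr : ∀ n : ℕ,
      z c n * (designProfile (w₁/W₁) (w₂/W₂) P P 1 1
          (fun p => resVec p (τ₁ p)) (fun p => resVec p (τ₂ p)) n
        - designProfile (w₁/W₁) (w₂/W₂) P P 1 1
          (fun p => resVec p (τ₁ p)) (fun p => resVec p (τ₂ p)) 1)
      = z c n * (w₁ * prodPhi P τ₁ n + w₂ * prodPhi P τ₂ n - (w₁ + w₂)) := by
    intro n
    rcases eq_or_ne n 0 with rfl | hn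
    · rw [z_zero, zero_mul, zero_mul]
    · rw [hΦ n hn, hΦ1]
  have hsumm := summable_z_mul_profile_diff H (w₁/W₁) (w₂/W₂) P P 1 1
      (fun p => resVec p (τ₁ p)) (fun p => resVec p (τ₂ p)) hP hP
  have h := H.type_ineq (w₁/W₁) (w₂/W₂) P P 1 1
    (fun p => resVec p (τ₁ p)) (fun p => resVec p (τ₂ p))
    (by positivity) (by positivity) hP hP hsumm
  rw [hΦ1] at h
  have hcongr' : ∀ n : ℕ,
      z c n * (designProfile (w₁/W₁) (w₂/W₂) P P 1 1
          (fun p => resVec p (τ₁ p)) (fun p => resVec p (τ₂ p)) n - (w₁ + w₂))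
      = z c n * (w₁ * prodPhi P τ₁ n + w₂ * prodPhi P τ₂ n - (w₁ + w₂)) := by
    intro n
    rcases eq_or_ne n 0 with rfl | hn
    · rw [z_zero, zero_mul, zero_mul]
    · rw [hΦ n hn]
  rw [tsum_congr hcongr'] at h
  exact ⟨hsumm.congr hcongr, h⟩

/-- The three-term engine (paper Prop. 4.1(iv) design). [folklore] -/
lemma three_design (H : TypeDesignHypotheses D c) (Q : Finset ℕ) (hQ : ∀ p ∈ Q, p.Prime) :
    Summable (fun n : ℕ => z c n * (prodPhi2 Q n - 1)) ∧
    H.C₁ + ∑' n : ℕ, z c n * (prodPhi2 Q n - 1) ≤ D := by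
  classical
  set W : ℝ := ∏ p ∈ Q, gW p with hWdef
  have hWpos : 0 < W := by
    rw [hWdef]
    exact Finset.prod_pos fun p hp' => gW_pos (hQ p hp')
  have hWne : W ≠ 0 := hWpos.ne'
  have hΦ : ∀ n : ℕ, n ≠ 0 →
      designProfile ((1/2)/W) ((1/2)/W) Q Q 2 2 (fun p => gVec p) (fun p => gVec p) n
        = prodPhi2 Q n := by
    intro n hn
    simp only [designProfile]
    rw [prod_gVec Q hQ n hn, ← hWdef]
    field_simp
    ring
  have hΦ1 : designProfile ((1/2)/W) ((1/2)/W) Q Q 2 2 (fun p => gVec p) (fun p => gVec p) 1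
      = 1 := by
    rw [hΦ 1 one_ne_zero, prodPhi2_one Q hQ]
  have hcongr : ∀ n : ℕ,
      z c n * (designProfile ((1/2)/W) ((1/2)/W) Q Q 2 2 (fun p => gVec p) (fun p => gVec p) n
        - designProfile ((1/2)/W) ((1/2)/W) Q Q 2 2 (fun p => gVec p) (fun p => gVec p) 1)
      = z c n * (prodPhi2 Q n - 1) := by
    intro n
    rcases eq_or_ne n 0 with rfl | hn
    · rw [z_zero, zero_mul, zero_mul]
    · rw [hΦ n hn, hΦ1]
  have hsumm := summable_z_mul_profile_diff H ((1/2)/W) ((1/2)/W) Q Q 2 2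
      (fun p => gVec p) (fun p => gVec p) hQ hQ
  have h := H.type_ineq ((1/2)/W) ((1/2)/W) Q Q 2 2 (fun p => gVec p) (fun p => gVec p)
    (by positivity) (by positivity) hQ hQ hsumm
  rw [hΦ1, one_mul, mul_one] at h
  have hcongr' : ∀ n : ℕ,
      z c n * (designProfile ((1/2)/W) ((1/2)/W) Q Q 2 2
          (fun p => gVec p) (fun p => gVec p) n - 1)
      = z c n * (prodPhi2 Q n - 1) := by
    intro n
    rcases eq_or_ne n 0 with rfl | hn
    · rw [z_zero, zero_mul, zero_mul]
    · rw [hΦ n hn]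
  rw [tsum_congr hcongr'] at h
  exact ⟨hsumm.congr hcongr, h⟩

/-! ## The trivial design: `C₁ ≤ D` -/

/-- Auxiliary step of the [CV] §§3–4 design calculus (adapted from the 2001 stockroom Lean leg). [folklore] -/
theorem C1_le (H : TypeDesignHypotheses D c) : H.C₁ ≤ D := by
  obtain ⟨_, h⟩ := two_design H ∅ (fun p hp => absurd hp (Finset.notMem_empty p))
    (fun _ => 0) (fun _ => 0)
    (fun p hp => absurd hp (Finset.notMem_empty p))
    (fun p hp => absurd hp (Finset.notMem_empty p))
    (1/2) (1/2) (by norm_num) (by norm_num)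
  have hφ : ∀ n : ℕ, prodPhi ∅ (fun _ => (0:ℝ)) n = 1 := by
    intro n
    unfold prodPhi
    rw [Finset.filter_empty, Finset.prod_empty]
  simp only [hφ] at h
  have hz : ∀ n : ℕ, z c n * ((1/2:ℝ) * 1 + (1/2) * 1 - ((1:ℝ)/2 + 1/2)) = 0 := by
    intro n; ring
  rw [tsum_congr hz, tsum_zero] at h
  linarith

/-! ## The even design and Proposition 4.1(i) -/

/-- `τ_p = (√p - 1)/2`, the right endpoint of `I_p` (paper §4). [folklore] -/
def tauP (p : ℕ) : ℝ := (Real.sqrt (p:ℝ) - 1)/2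

/-- Auxiliary step of the [CV] §§3–4 design calculus (adapted from the 2001 stockroom Lean leg). [folklore] -/
lemma tauP_nonneg (hp : p.Prime) : 0 ≤ tauP p := by
  have := one_lt_sqrt_prime hp
  unfold tauP
  linarith

/-- Auxiliary step of the [CV] §§3–4 design calculus (adapted from the 2001 stockroom Lean leg). [folklore] -/
lemma tauP_mono (_hq : q.Prime) (hpq : p ≤ q) : tauP p ≤ tauP q := by
  unfold tauP
  have := Real.sqrt_le_sqrt (show (p:ℝ) ≤ (q:ℝ) by exact_mod_cast hpq)
  linarith

/-- Auxiliary step of the [CV] §§3–4 design calculus (adapted from the 2001 stockroom Lean leg). [folklore] -/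
lemma tauP_mem_left (p : ℕ) : -((Real.sqrt (p:ℝ) + 1)/2) ≤ tauP p := by
  have := Real.sqrt_nonneg (p:ℝ)
  unfold tauP
  linarith

/-- `τ₂τ₃ ≤ τ_pτ_q` for any two distinct primes. [folklore] -/
lemma tau23_le (hp : p.Prime) (hq : q.Prime) (hpq : p ≠ q) :
    tauP 2 * tauP 3 ≤ tauP p * tauP q := by
  have h2 : Nat.Prime 2 := by norm_num
  have h3 : Nat.Prime 3 := by norm_num
  rcases eq_or_ne p 2 with rfl | hp2
  · have hq3 : 3 ≤ q := by
      have := hq.two_le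
      omega
    exact mul_le_mul le_rfl (tauP_mono hq hq3) (tauP_nonneg h3) (tauP_nonneg h2)
  · have hp3 : 3 ≤ p := by
      have := hp.two_le
      omega
    have hq2 : 2 ≤ q := hq.two_le
    calc tauP 2 * tauP 3 ≤ tauP q * tauP p :=
          mul_le_mul (tauP_mono hq hq2) (tauP_mono hp hp3) (tauP_nonneg h3) (tauP_nonneg hq)
    _ = tauP p * tauP q := mul_comm _ _

/-- Auxiliary step of the [CV] §§3–4 design calculus (adapted from the 2001 stockroom Lean leg). [folklore] -/
lemma tauP_pos (hp : p.Prime) : 0 < tauP p := by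
  have := one_lt_sqrt_prime hp
  unfold tauP
  linarith

/-- Auxiliary step of the [CV] §§3–4 design calculus (adapted from the 2001 stockroom Lean leg). [folklore] -/
lemma tau23_pos : 0 < tauP 2 * tauP 3 :=
  mul_pos (tauP_pos (by norm_num)) (tauP_pos (by norm_num))

/-- The even-mixture expansion `½∏(1+x) + ½∏(1-x) = Σ_{|B| even} ∏_B x`
(paper Prop. 4.1(i), display after (4.2)). [folklore] -/
lemma half_prod_add_half_prod_sub (A : Finset ℕ) (x : ℕ → ℝ) :
    (1/2) * (∏ p ∈ A, (1 + x p)) + (1/2) * (∏ p ∈ A, (1 - x p))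
      = ∑ B ∈ A.powerset.filter (fun B => Even B.card), ∏ p ∈ B, x p := by
  classical
  have h1 : ∏ p ∈ A, (1 + x p) = ∑ B ∈ A.powerset, ∏ p ∈ B, x p := by
    calc ∏ p ∈ A, (1 + x p) = ∏ p ∈ A, (x p + 1) :=
          Finset.prod_congr rfl fun p _ => by ring
    _ = ∑ B ∈ A.powerset, (∏ p ∈ B, x p) * ∏ p ∈ A \ B, 1 := Finset.prod_add x (fun _ => 1) A
    _ = ∑ B ∈ A.powerset, ∏ p ∈ B, x p := by
          refine Finset.sum_congr rfl fun B _ => ?_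
          rw [Finset.prod_const_one, mul_one]
  have h2 : ∏ p ∈ A, (1 - x p) = ∑ B ∈ A.powerset, (-1)^B.card * ∏ p ∈ B, x p := by
    calc ∏ p ∈ A, (1 - x p) = ∏ p ∈ A, ((-(x p)) + 1) :=
          Finset.prod_congr rfl fun p _ => by ring
    _ = ∑ B ∈ A.powerset, (∏ p ∈ B, -(x p)) * ∏ p ∈ A \ B, 1 :=
          Finset.prod_add (fun p => -(x p)) (fun _ => 1) A
    _ = ∑ B ∈ A.powerset, (-1)^B.card * ∏ p ∈ B, x p := by
          refine Finset.sum_congr rfl fun B _ => ?_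
          rw [Finset.prod_const_one, mul_one]
          calc ∏ p ∈ B, -(x p) = ∏ p ∈ B, ((-1) * x p) :=
                Finset.prod_congr rfl fun p _ => by ring
          _ = (∏ _p ∈ B, (-1:ℝ)) * ∏ p ∈ B, x p := Finset.prod_mul_distrib
          _ = (-1)^B.card * ∏ p ∈ B, x p := by rw [Finset.prod_const]
  rw [h1, h2, Finset.mul_sum, Finset.mul_sum, ← Finset.sum_add_distrib, Finset.sum_filter]
  refine Finset.sum_congr rfl fun B _ => ?_
  rcases Nat.even_or_odd B.card with he | ho
  · rw [if_pos he, he.neg_one_pow]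
    ring
  · have ho' := Nat.odd_iff.mp ho
    rw [if_neg (by rw [Nat.even_iff]; omega), ho.neg_one_pow]
    ring

/-- The even-design profile `Σ_{B ⊆ {p∈P : p∣n}, |B| even} ∏_B τ_p` (paper (4.2)). [folklore] -/
def evenPhi (P : Finset ℕ) (n : ℕ) : ℝ :=
  ∑ B ∈ (P.filter (· ∣ n)).powerset.filter (fun B => Even B.card), ∏ p ∈ B, tauP p

/-- Auxiliary step of the [CV] §§3–4 design calculus (adapted from the 2001 stockroom Lean leg). [folklore] -/
lemma evenPhi_one (P : Finset ℕ) (hP : ∀ p ∈ P, p.Prime) : evenPhi P 1 = 1 := by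
  unfold evenPhi
  rw [filter_dvd_one_eq_empty P hP, Finset.powerset_empty, Finset.filter_singleton,
    if_pos (by simp : Even (∅ : Finset ℕ).card)]
  simp

/-- Auxiliary step of the [CV] §§3–4 design calculus (adapted from the 2001 stockroom Lean leg). [folklore] -/
lemma one_le_evenPhi (P : Finset ℕ) (hP : ∀ p ∈ P, p.Prime) (n : ℕ) :
    1 ≤ evenPhi P n := by
  unfold evenPhi
  have hempty : (∅ : Finset ℕ) ∈ (P.filter (· ∣ n)).powerset.filter (fun B => Even B.card) := by
    rw [Finset.mem_filter]
    exact ⟨Finset.empty_mem_powerset _, by simp⟩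
  have hnn : ∀ B ∈ (P.filter (· ∣ n)).powerset.filter (fun B => Even B.card),
      (0:ℝ) ≤ ∏ p ∈ B, tauP p := by
    intro B hB
    apply Finset.prod_nonneg
    intro r hrB
    have hrP : r ∈ P :=
      Finset.filter_subset _ _
        ((Finset.mem_powerset.mp (Finset.mem_filter.mp hB).1) hrB)
    exact tauP_nonneg (hP r hrP)
  have := Finset.single_le_sum hnn hempty
  simpa using this

/-- Auxiliary step of the [CV] §§3–4 design calculus (adapted from the 2001 stockroom Lean leg). [folklore] -/
lemma evenPhi_eq_one_of_card_le_one (P : Finset ℕ) (n : ℕ)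
    (hcard : (P.filter (· ∣ n)).card ≤ 1) : evenPhi P n = 1 := by
  unfold evenPhi
  have hset : (P.filter (· ∣ n)).powerset.filter (fun B => Even B.card)
      = {(∅ : Finset ℕ)} := by
    apply Finset.eq_singleton_iff_unique_mem.mpr
    constructor
    · rw [Finset.mem_filter]
      exact ⟨Finset.empty_mem_powerset _, by simp⟩
    · intro B hB
      rw [Finset.mem_filter, Finset.mem_powerset] at hB
      obtain ⟨hsub, heven⟩ := hB
      have hcB : B.card ≤ 1 := le_trans (Finset.card_le_card hsub) hcard
      obtain ⟨t, ht⟩ := heven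
      have : B.card = 0 := by omega
      exact Finset.card_eq_zero.mp this
  rw [hset]
  simp

/-- Auxiliary step of the [CV] §§3–4 design calculus (adapted from the 2001 stockroom Lean leg). [folklore] -/
lemma pair_le_evenPhi (P : Finset ℕ) (hP : ∀ p ∈ P, p.Prime) (n : ℕ)
    (hpmem : p ∈ P.filter (· ∣ n)) (hqmem : q ∈ P.filter (· ∣ n)) (hpq : p ≠ q) :
    1 + tauP p * tauP q ≤ evenPhi P n := by
  unfold evenPhi
  have hnn : ∀ B ∈ (P.filter (· ∣ n)).powerset.filter (fun B => Even B.card),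
      B ∉ ({∅, {p, q}} : Finset (Finset ℕ)) → (0:ℝ) ≤ ∏ r ∈ B, tauP r := by
    intro B hB _
    apply Finset.prod_nonneg
    intro r hrB
    have hrP : r ∈ P :=
      Finset.filter_subset _ _
        ((Finset.mem_powerset.mp (Finset.mem_filter.mp hB).1) hrB)
    exact tauP_nonneg (hP r hrP)
  have hsub : ({∅, {p, q}} : Finset (Finset ℕ))
      ⊆ (P.filter (· ∣ n)).powerset.filter (fun B => Even B.card) := by
    intro B hB
    rcases Finset.mem_insert.mp hB with rfl | hB'
    · rw [Finset.mem_filter]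
      exact ⟨Finset.empty_mem_powerset _, by simp⟩
    · rw [Finset.mem_singleton] at hB'
      subst hB'
      rw [Finset.mem_filter, Finset.mem_powerset]
      constructor
      · intro r hr
        rcases Finset.mem_insert.mp hr with rfl | hr'
        · exact hpmem
        · rw [Finset.mem_singleton] at hr'
          subst hr'
          exact hqmem
      · rw [Finset.card_pair hpq]
        decide
  have hpair : ∑ B ∈ ({∅, {p, q}} : Finset (Finset ℕ)), ∏ r ∈ B, tauP r
      = 1 + tauP p * tauP q := by
    have hne : (∅ : Finset ℕ) ≠ {p, q} := (Finset.insert_ne_empty p {q}).symm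
    rw [Finset.sum_pair hne, Finset.prod_empty, Finset.prod_pair hpq]
  calc 1 + tauP p * tauP q
      = ∑ B ∈ ({∅, {p, q}} : Finset (Finset ℕ)), ∏ r ∈ B, tauP r := hpair.symm
    _ ≤ ∑ B ∈ (P.filter (· ∣ n)).powerset.filter (fun B => Even B.card), ∏ r ∈ B, tauP r :=
        Finset.sum_le_sum_of_subset_of_nonneg hsub hnn

/-- Pointwise sign: `z(n)·(evenΦ(n) - 1) ≥ 0` for every `n` (the even design's
remainder is supported on composites, where `z ≥ 0`). [folklore] -/
lemma z_mul_evenR_nonneg (H : TypeDesignHypotheses D c) (P : Finset ℕ)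
    (hP : ∀ p ∈ P, p.Prime) (n : ℕ) : 0 ≤ z c n * (evenPhi P n - 1) := by
  rcases eq_or_ne n 0 with rfl | hn0
  · rw [z_zero, zero_mul]
  · by_cases hcard : (P.filter (· ∣ n)).card ≤ 1
    · rw [evenPhi_eq_one_of_card_le_one P n hcard, sub_self, mul_zero]
    · have hcomp : IsComposite n := by
        have hgt : 1 < (P.filter (· ∣ n)).card := by omega
        obtain ⟨p', hp', q', hq', hpq'⟩ := Finset.one_lt_card.mp hgt
        have hpF := Finset.mem_filter.mp hp'
        have hqF := Finset.mem_filter.mp hq'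
        constructor
        · have h1 := Nat.le_of_dvd (Nat.pos_of_ne_zero hn0) hpF.2
          have h2 := (hP p' hpF.1).two_le
          omega
        · intro hpp
          exact hpq' (prime_eq_of_dvd_isPrimePow hpp (hP p' hpF.1) (hP q' hqF.1) hpF.2 hqF.2)
      apply mul_nonneg (z_nonneg_of_comp H.nonneg hcomp)
      have := one_le_evenPhi P hP n
      linarith

/-- The even design (paper Prop. 4.1(i), fixed level): summability and the bound. [folklore] -/
lemma even_design (H : TypeDesignHypotheses D c) (P : Finset ℕ) (hP : ∀ p ∈ P, p.Prime) :
    Summable (fun n : ℕ => z c n * (evenPhi P n - 1)) ∧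
    H.C₁ + ∑' n : ℕ, z c n * (evenPhi P n - 1) ≤ D := by
  have hr₁ : ∀ p ∈ P,
      -((Real.sqrt (p:ℝ) + 1)/2) ≤ tauP p ∧ tauP p ≤ (Real.sqrt (p:ℝ) - 1)/2 := by
    intro p hp'
    exact ⟨tauP_mem_left p, le_of_eq rfl⟩
  have hr₂ : ∀ p ∈ P,
      -((Real.sqrt (p:ℝ) + 1)/2) ≤ -(tauP p) ∧ -(tauP p) ≤ (Real.sqrt (p:ℝ) - 1)/2 := by
    intro p hp'
    have h1 := one_lt_sqrt_prime (hP p hp')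
    unfold tauP
    exact ⟨by linarith, by linarith⟩
  obtain ⟨hsum, h⟩ := two_design H P hP tauP (fun p => -(tauP p)) hr₁ hr₂ (1/2) (1/2)
    (by norm_num) (by norm_num)
  have hmix : ∀ n : ℕ,
      (1/2 : ℝ) * prodPhi P tauP n + (1/2) * prodPhi P (fun p => -(tauP p)) n
        - ((1:ℝ)/2 + 1/2) = evenPhi P n - 1 := by
    intro n
    have key := half_prod_add_half_prod_sub (P.filter (· ∣ n)) tauP
    have e3 : prodPhi P (fun p => -(tauP p)) n = ∏ p ∈ P.filter (· ∣ n), (1 - tauP p) :=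
      Finset.prod_congr rfl fun p _ => by ring
    rw [e3]
    unfold prodPhi evenPhi
    linarith [key]
  constructor
  · exact hsum.congr fun n => by rw [hmix n]
  · have heq : ∑' n : ℕ, z c n * ((1/2 : ℝ) * prodPhi P tauP n
        + (1/2) * prodPhi P (fun p => -(tauP p)) n - ((1:ℝ)/2 + 1/2))
        = ∑' n : ℕ, z c n * (evenPhi P n - 1) := tsum_congr fun n => by rw [hmix n]
    rw [heq] at h
    linarith

/-- Prop. 4.1(i), partial-sum form, with defect `D`: `(τ₂τ₃)·Σ_{n∈F} cWeight(n) ≤ D - C₁`. [folklore] -/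
lemma sum_cWeight_le (H : TypeDesignHypotheses D c) (F : Finset ℕ) :
    (tauP 2 * tauP 3) * ∑ n ∈ F, cWeight c n ≤ D - H.C₁ := by
  classical
  set M := F.sup id with hM
  set P := (range (M+1)).filter Nat.Prime with hPdef
  have hP : ∀ p ∈ P, p.Prime := fun p hp' => (Finset.mem_filter.mp hp').2
  obtain ⟨hsum, hbound⟩ := even_design H P hP
  have hpt : ∀ n ∈ F, (tauP 2 * tauP 3) * cWeight c n ≤ z c n * (evenPhi P n - 1) := by
    intro n hnF
    by_cases hcomp : IsComposite n
    · obtain ⟨p', q', hpm, hqm, hpq'⟩ := exists_two_primeFactors hcomp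
      have hpprime := (Nat.mem_primeFactors.mp hpm).1
      have hqprime := (Nat.mem_primeFactors.mp hqm).1
      have hpd := (Nat.mem_primeFactors.mp hpm).2.1
      have hqd := (Nat.mem_primeFactors.mp hqm).2.1
      have hn0 : 0 < n := by
        have := hcomp.1
        omega
      have hnM : n ≤ M := by
        rw [hM]
        exact Finset.le_sup (f := id) hnF
      have hpP : p' ∈ P.filter (· ∣ n) := by
        rw [Finset.mem_filter, hPdef, Finset.mem_filter, Finset.mem_range]
        have := Nat.le_of_dvd hn0 hpd
        exact ⟨⟨by omega, hpprime⟩, hpd⟩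
      have hqP : q' ∈ P.filter (· ∣ n) := by
        rw [Finset.mem_filter, hPdef, Finset.mem_filter, Finset.mem_range]
        have := Nat.le_of_dvd hn0 hqd
        exact ⟨⟨by omega, hqprime⟩, hqd⟩
      have h1 : 1 + tauP p' * tauP q' ≤ evenPhi P n := pair_le_evenPhi P hP n hpP hqP hpq'
      have h2 : tauP 2 * tauP 3 ≤ tauP p' * tauP q' := tau23_le hpprime hqprime hpq'
      have h4 : cWeight c n = c n / n := by unfold cWeight; rw [if_pos hcomp]
      have h5 : (0:ℝ) ≤ c n / (n:ℝ) := div_nonneg (H.nonneg n) (Nat.cast_nonneg n)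
      rw [h4, z_eq_of_comp hcomp]
      have h6 : tauP 2 * tauP 3 ≤ evenPhi P n - 1 := by linarith
      calc (tauP 2 * tauP 3) * (c n / n) ≤ (evenPhi P n - 1) * (c n / n) :=
            mul_le_mul_of_nonneg_right h6 h5
      _ = c n / n * (evenPhi P n - 1) := mul_comm _ _
    · have h4 : cWeight c n = 0 := by unfold cWeight; rw [if_neg hcomp]
      rw [h4, mul_zero]
      exact z_mul_evenR_nonneg H P hP n
  have hsumF : (tauP 2 * tauP 3) * ∑ n ∈ F, cWeight c n
      ≤ ∑ n ∈ F, z c n * (evenPhi P n - 1) := by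
    rw [Finset.mul_sum]
    exact Finset.sum_le_sum hpt
  have htail : ∑ n ∈ F, z c n * (evenPhi P n - 1) ≤ ∑' n, z c n * (evenPhi P n - 1) :=
    Summable.sum_le_tsum F (fun n _ => z_mul_evenR_nonneg H P hP n) hsum
  linarith

/-- Prop. 4.1(i): the composite mass is finite. [folklore] -/
theorem prop41_i_summable (H : TypeDesignHypotheses D c) : Summable (cWeight c) := by
  have hτ := tau23_pos
  apply summable_of_sum_le (fun n => cWeight_nonneg H n)
  intro F
  have h := sum_cWeight_le H F
  exact (le_div_iff₀' hτ).mpr h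

/-- Prop. 4.1(i) with defect `D`: `(τ₂τ₃)·Σ_composite c(n)/n ≤ D - C₁`, `C₁ = Σ_n (c(n)-Λ(n))/n`. [folklore] -/
theorem prop41_i_bound (H : TypeDesignHypotheses D c) :
    (tauP 2 * tauP 3) * ∑' n, cWeight c n ≤ D - H.C₁ := by
  have hτ := tau23_pos
  rw [mul_comm, ← le_div_iff₀ hτ]
  apply Summable.tsum_le_of_sum_le (prop41_i_summable H)
  intro F
  exact (le_div_iff₀' hτ).mpr (sum_cWeight_le H F)

/-! ## Splitting off the prime powers, and Prop. 4.1(ii)-(iv) -/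

/-- Auxiliary step of the [CV] §§3–4 design calculus (adapted from the 2001 stockroom Lean leg). [folklore] -/
lemma summable_ite_not_pp {ψ : ℕ → ℝ} (hs : Summable ψ) :
    Summable fun n => if IsPrimePow n then 0 else ψ n := by
  apply Summable.of_abs
  apply Summable.of_nonneg_of_le (fun n => abs_nonneg _) _ hs.abs
  intro n
  split
  · rw [abs_zero]
    exact abs_nonneg _
  · exact le_rfl

/-- Auxiliary step of the [CV] §§3–4 design calculus (adapted from the 2001 stockroom Lean leg). [folklore] -/
lemma summable_ite_pp {ψ : ℕ → ℝ} (hs : Summable ψ) :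
    Summable fun n => if IsPrimePow n then ψ n else 0 := by
  apply Summable.of_abs
  apply Summable.of_nonneg_of_le (fun n => abs_nonneg _) _ hs.abs
  intro n
  split
  · exact le_rfl
  · rw [abs_zero]
    exact abs_nonneg _

/-- Split a summable function supported on `{n ≥ 2 : some p ∈ Q divides n}` into
its prime-power part (regrouped by `p ∈ Q`) and its composite part. [folklore] -/
lemma tsum_split_primePow (Q : Finset ℕ) (hQ : ∀ p ∈ Q, p.Prime) (ψ : ℕ → ℝ)
    (hs : Summable ψ) (hsupp : ∀ n, ψ n ≠ 0 → 2 ≤ n ∧ ∃ p ∈ Q, p ∣ n) :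
    ∑' n, ψ n = (∑ p ∈ Q, ∑' k, ψ (p ^ (k+1)))
      + ∑' n, (if IsPrimePow n then 0 else ψ n) := by
  classical
  have hs₁ : Summable fun n => if IsPrimePow n then ψ n else 0 := summable_ite_pp hs
  have hs₂ : Summable fun n => if IsPrimePow n then 0 else ψ n := summable_ite_not_pp hs
  have hsplit : ∀ n, ψ n = (if IsPrimePow n then ψ n else 0)
      + (if IsPrimePow n then 0 else ψ n) := by
    intro n
    split <;> ring
  rw [show ∑' n, ψ n = ∑' n, ((if IsPrimePow n then ψ n else 0)
      + (if IsPrimePow n then 0 else ψ n)) from tsum_congr hsplit]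
  rw [hs₁.tsum_add hs₂]
  congr 1
  rw [tsum_primePow_group Q hQ _ hs₁ ?_]
  · refine Finset.sum_congr rfl fun p hpQ => tsum_congr fun k => ?_
    rw [if_pos ⟨p, k+1, (hQ p hpQ).prime, Nat.succ_pos k, rfl⟩]
  · intro n hn
    by_cases hpp : IsPrimePow n
    · rw [if_pos hpp] at hn
      obtain ⟨h2, p, hpQ, hpd⟩ := hsupp n hn
      obtain ⟨r, k, hr, hk, hrk⟩ := (isPrimePow_nat_iff n).mp hpp
      have hrp : r = p := prime_eq_of_dvd_isPrimePow hpp hr (hQ p hpQ)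
        (hrk ▸ dvd_pow_self r hk.ne') hpd
      refine ⟨p, hpQ, k - 1, ?_⟩
      rw [← hrk, hrp]
      congr 1
      omega
    · rw [if_neg hpp] at hn
      exact absurd rfl hn

/-- Auxiliary step of the [CV] §§3–4 design calculus (adapted from the 2001 stockroom Lean leg). [folklore] -/
lemma filter_dvd_primePow (Q : Finset ℕ) (hQ : ∀ q ∈ Q, q.Prime) (hpQ : p ∈ Q) (k : ℕ) :
    Q.filter (· ∣ p ^ (k+1)) = {p} := by
  ext q
  simp only [Finset.mem_filter, Finset.mem_singleton]
  constructor
  · rintro ⟨hqQ, hqd⟩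
    exact (Nat.prime_dvd_prime_iff_eq (hQ q hqQ) (hQ p hpQ)).mp
      ((hQ q hqQ).dvd_of_dvd_pow hqd)
  · rintro rfl
    exact ⟨hpQ, dvd_pow_self _ (Nat.succ_ne_zero k)⟩

/-- Auxiliary step of the [CV] §§3–4 design calculus (adapted from the 2001 stockroom Lean leg). [folklore] -/
lemma prodPhi_primePow (Q : Finset ℕ) (hQ : ∀ q ∈ Q, q.Prime) (hpQ : p ∈ Q)
    (τf : ℕ → ℝ) (k : ℕ) : prodPhi Q τf (p ^ (k+1)) = 1 + τf p := by
  unfold prodPhi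
  rw [filter_dvd_primePow Q hQ hpQ k, Finset.prod_singleton]

/-- Auxiliary step of the [CV] §§3–4 design calculus (adapted from the 2001 stockroom Lean leg). [folklore] -/
lemma filter_sq_dvd_primePow (Q : Finset ℕ) (hQ : ∀ q ∈ Q, q.Prime) (hpQ : p ∈ Q) (k : ℕ) :
    Q.filter (fun q => q ^ 2 ∣ p ^ (k+1)) = if 1 ≤ k then {p} else ∅ := by
  rcases Nat.eq_zero_or_pos k with rfl | hk
  · rw [if_neg (by omega)]
    rw [Finset.filter_eq_empty_iff]
    intro q hqQ hqd
    have hq := hQ q hqQ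
    have hp := hQ p hpQ
    rw [zero_add, pow_one] at hqd
    have h1 : q ∣ p := dvd_trans (dvd_pow_self q two_ne_zero) hqd
    have h2 : q = p := (Nat.prime_dvd_prime_iff_eq hq hp).mp h1
    rw [h2] at hqd
    have h3 : p ^ 2 ≤ p := Nat.le_of_dvd hp.pos hqd
    have h4 : p ^ 2 = p * p := pow_two p
    have := hp.two_le
    nlinarith
  · rw [if_pos (show 1 ≤ k by omega)]
    ext q
    simp only [Finset.mem_filter, Finset.mem_singleton]
    constructor
    · rintro ⟨hqQ, hqd⟩
      have h1 : q ∣ p ^ (k+1) := dvd_trans (dvd_pow_self q two_ne_zero) hqd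
      exact (Nat.prime_dvd_prime_iff_eq (hQ q hqQ) (hQ p hpQ)).mp
        ((hQ q hqQ).dvd_of_dvd_pow h1)
    · rintro rfl
      exact ⟨hpQ, pow_dvd_pow _ (by omega)⟩

/-- Prop. 4.1(ii) (boosting) with defect `D`: `Σ_{p∈Q} τ_p D_p ≤ D - C₁` for every finite prime set.
[folklore] -/
theorem boost_bound (H : TypeDesignHypotheses D c) (Q : Finset ℕ)
    (hQ : ∀ p ∈ Q, p.Prime) : ∑ p ∈ Q, tauP p * Dp c p ≤ D - H.C₁ := by
  classical
  have hr : ∀ p ∈ Q,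
      -((Real.sqrt (p:ℝ) + 1)/2) ≤ tauP p ∧ tauP p ≤ (Real.sqrt (p:ℝ) - 1)/2 := by
    intro p hp'
    exact ⟨tauP_mem_left p, le_of_eq rfl⟩
  obtain ⟨hsum, hbound⟩ := two_design H Q hQ tauP tauP hr hr (1/2) (1/2)
    (by norm_num) (by norm_num)
  have hform : ∀ n : ℕ, z c n * ((1/2:ℝ) * prodPhi Q tauP n + (1/2) * prodPhi Q tauP n
      - ((1:ℝ)/2 + 1/2)) = z c n * (prodPhi Q tauP n - 1) := by
    intro n; ring
  have hsum' : Summable fun n => z c n * (prodPhi Q tauP n - 1) := hsum.congr hform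
  have hbound' : H.C₁ + ∑' n, z c n * (prodPhi Q tauP n - 1) ≤ D := by
    rw [tsum_congr hform] at hbound
    linarith
  have hsupp : ∀ n, z c n * (prodPhi Q tauP n - 1) ≠ 0 → 2 ≤ n ∧ ∃ p ∈ Q, p ∣ n := by
    intro n hn
    constructor
    · by_contra hlt
      have hn2 : n < 2 := by omega
      interval_cases n
      · exact hn (by rw [z_zero, zero_mul])
      · exact hn (by rw [prodPhi_one Q hQ, sub_self, mul_zero])
    · by_contra hnone
      apply hn
      have hemp : Q.filter (· ∣ n) = ∅ := by
        rw [Finset.filter_eq_empty_iff]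
        intro q hqQ hqd
        exact hnone ⟨q, hqQ, hqd⟩
      unfold prodPhi
      rw [hemp, Finset.prod_empty, sub_self, mul_zero]
  rw [tsum_split_primePow Q hQ _ hsum' hsupp] at hbound'
  have hpp : ∀ p ∈ Q, ∑' k, z c (p^(k+1)) * (prodPhi Q tauP (p^(k+1)) - 1)
      = tauP p * Dp c p := by
    intro p hpQ
    have hptw : ∀ k : ℕ, z c (p^(k+1)) * (prodPhi Q tauP (p^(k+1)) - 1)
        = tauP p * z c (p^(k+1)) := by
      intro k
      rw [prodPhi_primePow Q hQ hpQ tauP k]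
      ring
    rw [tsum_congr hptw, tsum_mul_left]
    rfl
  rw [Finset.sum_congr rfl hpp] at hbound'
  have hcomp0 : 0 ≤ ∑' n, (if IsPrimePow n then 0 else z c n * (prodPhi Q tauP n - 1)) := by
    apply tsum_nonneg
    intro n
    by_cases hpp' : IsPrimePow n
    · rw [if_pos hpp']
    · rw [if_neg hpp']
      rcases lt_or_ge n 2 with hn2 | hn2
      · interval_cases n
        · rw [z_zero, zero_mul]
        · rw [z_one H.c_one, zero_mul]
      · have hcomp' : IsComposite n := ⟨hn2, hpp'⟩
        apply mul_nonneg (z_nonneg_of_comp H.nonneg hcomp')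
        have h1 : (1:ℝ) ≤ prodPhi Q tauP n := by
          unfold prodPhi
          calc (1:ℝ) = ∏ _q ∈ Q.filter (· ∣ n), (1:ℝ) := Finset.prod_const_one.symm
          _ ≤ ∏ q ∈ Q.filter (· ∣ n), (1 + tauP q) := by
              apply Finset.prod_le_prod (fun q _ => by norm_num)
              intro q hq'
              have := tauP_nonneg (hQ q (Finset.mem_filter.mp hq').1)
              linarith
        linarith
  linarith

/-- Prop. 4.1(iii) (Euler-factor removal) with defect `D`:
`C₁ ≤ D + Σ_{p∈R} D_p + Σ_composite c(n)/n` for every finite prime set `R`. [folklore] -/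
theorem euler_bound (H : TypeDesignHypotheses D c) (R : Finset ℕ)
    (hR : ∀ p ∈ R, p.Prime) :
    H.C₁ ≤ D + (∑ p ∈ R, Dp c p) + ∑' n, cWeight c n := by
  classical
  have hr : ∀ p ∈ R,
      -((Real.sqrt (p:ℝ) + 1)/2) ≤ (-1:ℝ) ∧ (-1:ℝ) ≤ (Real.sqrt (p:ℝ) - 1)/2 := by
    intro p hp'
    have h1 := one_lt_sqrt_prime (hR p hp')
    exact ⟨by linarith, by linarith⟩
  obtain ⟨hsum, hbound⟩ := two_design H R hR (fun _ => -1) (fun _ => -1) hr hr (1/2) (1/2)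
    (by norm_num) (by norm_num)
  have hform : ∀ n : ℕ, z c n * ((1/2:ℝ) * prodPhi R (fun _ => -1) n
      + (1/2) * prodPhi R (fun _ => -1) n - ((1:ℝ)/2 + 1/2))
      = z c n * (prodPhi R (fun _ => -1) n - 1) := by
    intro n; ring
  have hsum' : Summable fun n => z c n * (prodPhi R (fun _ => (-1:ℝ)) n - 1) :=
    hsum.congr hform
  have hbound' : H.C₁ + ∑' n, z c n * (prodPhi R (fun _ => (-1:ℝ)) n - 1) ≤ D := by
    rw [tsum_congr hform] at hbound
    linarith
  have hA01 : ∀ n, prodPhi R (fun _ => (-1:ℝ)) n = 0 ∨ prodPhi R (fun _ => (-1:ℝ)) n = 1 := by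
    intro n
    unfold prodPhi
    by_cases hex : (R.filter (· ∣ n)).Nonempty
    · left
      obtain ⟨q', hq'⟩ := hex
      exact Finset.prod_eq_zero hq' (by norm_num)
    · right
      rw [Finset.not_nonempty_iff_eq_empty.mp hex, Finset.prod_empty]
  have hsupp : ∀ n, z c n * (prodPhi R (fun _ => (-1:ℝ)) n - 1) ≠ 0
      → 2 ≤ n ∧ ∃ p ∈ R, p ∣ n := by
    intro n hn
    constructor
    · by_contra hlt
      have hn2 : n < 2 := by omega
      interval_cases n
      · exact hn (by rw [z_zero, zero_mul])
      · exact hn (by rw [prodPhi_one R hR, sub_self, mul_zero])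
    · by_contra hnone
      apply hn
      have hemp : R.filter (· ∣ n) = ∅ := by
        rw [Finset.filter_eq_empty_iff]
        intro q hqR hqd
        exact hnone ⟨q, hqR, hqd⟩
      unfold prodPhi
      rw [hemp, Finset.prod_empty, sub_self, mul_zero]
  rw [tsum_split_primePow R hR _ hsum' hsupp] at hbound'
  have hpp : ∀ p ∈ R, ∑' k, z c (p^(k+1)) * (prodPhi R (fun _ => (-1:ℝ)) (p^(k+1)) - 1)
      = -Dp c p := by
    intro p hpR
    have hptw : ∀ k : ℕ, z c (p^(k+1)) * (prodPhi R (fun _ => (-1:ℝ)) (p^(k+1)) - 1)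
        = -(z c (p^(k+1))) := by
      intro k
      rw [prodPhi_primePow R hR hpR _ k]
      ring
    rw [tsum_congr hptw, tsum_neg]
    rfl
  rw [Finset.sum_congr rfl hpp] at hbound'
  have hsneg : ∑ p ∈ R, -Dp c p = -∑ p ∈ R, Dp c p := by
    rw [← Finset.sum_neg_distrib]
  rw [hsneg] at hbound'
  -- the composite piece dominates `-B`
  have hcomp_ge : -∑' n, (if IsPrimePow n then 0
      else z c n * (prodPhi R (fun _ => (-1:ℝ)) n - 1)) ≤ ∑' n, cWeight c n := by
    rw [← tsum_neg]
    apply Summable.tsum_le_tsum _ (summable_ite_not_pp hsum').neg (prop41_i_summable H)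
    intro n
    by_cases hpp' : IsPrimePow n
    · rw [if_pos hpp', neg_zero]
      exact cWeight_nonneg H n
    · rw [if_neg hpp']
      rcases lt_or_ge n 2 with hn2 | hn2
      · interval_cases n
        · rw [z_zero, zero_mul, neg_zero]
          exact cWeight_nonneg H 0
        · rw [z_one H.c_one, zero_mul, neg_zero]
          exact cWeight_nonneg H 1
      · have hcomp' : IsComposite n := ⟨hn2, hpp'⟩
        have h5 : (0:ℝ) ≤ c n / (n:ℝ) := div_nonneg (H.nonneg n) (Nat.cast_nonneg n)
        have hcw : cWeight c n = c n / n := by unfold cWeight; rw [if_pos hcomp']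
        rw [hcw, z_eq_of_comp hcomp']
        rcases hA01 n with h0 | h1
        · rw [h0]
          nlinarith
        · rw [h1]
          nlinarith
  linarith

/-- Prop. 4.1(iv) (three-term factor) with defect `D`: `Σ_{p∈Q} τ'_p T₁(p) ≤ D - C₁`. [folklore] -/
theorem threeTerm_bound (H : TypeDesignHypotheses D c) (Q : Finset ℕ)
    (hQ : ∀ p ∈ Q, p.Prime) : ∑ p ∈ Q, gTau p * T1p c p ≤ D - H.C₁ := by
  classical
  obtain ⟨hsum, hbound⟩ := three_design H Q hQ
  have hsupp : ∀ n, z c n * (prodPhi2 Q n - 1) ≠ 0 → 2 ≤ n ∧ ∃ p ∈ Q, p ∣ n := by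
    intro n hn
    constructor
    · by_contra hlt
      have hn2 : n < 2 := by omega
      interval_cases n
      · exact hn (by rw [z_zero, zero_mul])
      · exact hn (by rw [prodPhi2_one Q hQ, sub_self, mul_zero])
    · by_contra hnone
      apply hn
      have hemp : Q.filter (fun q => q ^ 2 ∣ n) = ∅ := by
        rw [Finset.filter_eq_empty_iff]
        intro q hqQ hqd
        exact hnone ⟨q, hqQ, dvd_trans (dvd_pow_self q two_ne_zero) hqd⟩
      unfold prodPhi2
      rw [hemp, Finset.prod_empty, sub_self, mul_zero]
  rw [tsum_split_primePow Q hQ _ hsum hsupp] at hbound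
  have hpp : ∀ p ∈ Q, ∑' k, z c (p^(k+1)) * (prodPhi2 Q (p^(k+1)) - 1)
      = gTau p * T1p c p := by
    intro p hpQ
    have hval : ∀ k : ℕ, prodPhi2 Q (p^((k+1)+1)) = 1 + gTau p := by
      intro k
      unfold prodPhi2
      rw [filter_sq_dvd_primePow Q hQ hpQ (k+1), if_pos (by omega),
        Finset.prod_singleton]
    have hs' : Summable fun k : ℕ =>
        z c (p^((k+1)+1)) * (prodPhi2 Q (p^((k+1)+1)) - 1) := by
      apply Summable.congr ((summable_z_pp2 H (hQ p hpQ)).mul_left (gTau p))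
      intro k
      rw [hval k]
      ring
    rw [tsum_eq_zero_add'
      (f := fun k => z c (p^(k+1)) * (prodPhi2 Q (p^(k+1)) - 1)) hs']
    have h0 : z c (p^(0+1)) * (prodPhi2 Q (p^(0+1)) - 1) = 0 := by
      have hone : prodPhi2 Q (p^(0+1)) = 1 := by
        unfold prodPhi2
        rw [filter_sq_dvd_primePow Q hQ hpQ 0, if_neg (by omega), Finset.prod_empty]
      rw [hone, sub_self, mul_zero]
    rw [h0, zero_add]
    have hcongr2 : ∀ k : ℕ, z c (p^((k+1)+1)) * (prodPhi2 Q (p^((k+1)+1)) - 1)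
        = gTau p * z c (p^(k+2)) := by
      intro k
      rw [hval k]
      ring
    rw [tsum_congr hcongr2, tsum_mul_left]
    rfl
  rw [Finset.sum_congr rfl hpp] at hbound
  have hcomp0 : 0 ≤ ∑' n, (if IsPrimePow n then 0 else z c n * (prodPhi2 Q n - 1)) := by
    apply tsum_nonneg
    intro n
    by_cases hpp' : IsPrimePow n
    · rw [if_pos hpp']
    · rw [if_neg hpp']
      rcases lt_or_ge n 2 with hn2 | hn2
      · interval_cases n
        · rw [z_zero, zero_mul]
        · rw [z_one H.c_one, zero_mul]
      · have hcomp' : IsComposite n := ⟨hn2, hpp'⟩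
        apply mul_nonneg (z_nonneg_of_comp H.nonneg hcomp')
        have h1 : (1:ℝ) ≤ prodPhi2 Q n := by
          unfold prodPhi2
          calc (1:ℝ) = ∏ _q ∈ Q.filter (fun q => q ^ 2 ∣ n), (1:ℝ) :=
                Finset.prod_const_one.symm
          _ ≤ ∏ q ∈ Q.filter (fun q => q ^ 2 ∣ n), (1 + gTau q) := by
              apply Finset.prod_le_prod (fun q _ => by norm_num)
              intro q hq'
              have := gTau_nonneg (hQ q (Finset.mem_filter.mp hq').1)
              linarith
        linarith
  linarith

/-! ## Proposition 4.1(v): `Σ_n |z(n)| < ∞` -/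

/-- Per-prime bound: `Σ_{k≥1}|z(p^k)| ≤ |D_p| + 2 T₁(p) + 4 logMaj(p)`. [folklore] -/
lemma Zp_le (H : TypeDesignHypotheses D c) (hp : p.Prime) :
    ∑' k : ℕ, |z c (p^(k+1))| ≤ |Dp c p| + 2 * T1p c p + 4 * logMaj p := by
  have h1 : ∑' k : ℕ, |z c (p^(k+1))| = |z c p| + ∑' k : ℕ, |z c (p^(k+2))| := by
    rw [tsum_eq_zero_add' ((summable_nat_add_iff 1).mpr (H.summable_pp p hp))]
    congr 1
    norm_num
  have h3 : |T1p c p| ≤ ∑' k : ℕ, |z c (p^(k+2))| := by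
    have habs := summable_abs_z_pp2 H hp
    have hnorm : Summable fun k : ℕ => ‖z c (p^(k+2))‖ := by
      simpa [Real.norm_eq_abs] using habs
    calc |T1p c p| = ‖∑' k : ℕ, z c (p^(k+2))‖ := (Real.norm_eq_abs _).symm
    _ ≤ ∑' k : ℕ, ‖z c (p^(k+2))‖ := norm_tsum_le_tsum_norm hnorm
    _ = ∑' k : ℕ, |z c (p^(k+2))| := by simp [Real.norm_eq_abs]
  have h2 : |z c p| ≤ |Dp c p| + ∑' k : ℕ, |z c (p^(k+2))| := by
    have hD := Dp_eq_z_add_T1p H hp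
    have hzp : z c p = Dp c p - T1p c p := by linarith
    rw [hzp, sub_eq_add_neg]
    refine (abs_add_le _ _).trans ?_
    rw [abs_neg]
    linarith
  have h4 := tsum_abs_tail_le H hp
  have h5 : Real.log p * ((p:ℝ) * ((p:ℝ) - 1))⁻¹ = logMaj p := (logMaj_prime hp).symm
  rw [h5] at h4
  rw [h1]
  linarith

/-- `Σ_{p∈P}|D_p| ≤ (D - C₁)/τ₂ + (D + B - C₁)` (combining (ii) and (iii)). [folklore] -/
lemma sum_abs_Dp_le (H : TypeDesignHypotheses D c) (P : Finset ℕ)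
    (hP : ∀ p ∈ P, p.Prime) :
    ∑ p ∈ P, |Dp c p| ≤ (D - H.C₁) / tauP 2 + (D + ∑' n, cWeight c n - H.C₁) := by
  classical
  have h1 : ∑ p ∈ P, |Dp c p| = (∑ p ∈ P.filter (fun p => 0 ≤ Dp c p), Dp c p)
      + ∑ p ∈ P.filter (fun p => ¬ 0 ≤ Dp c p), -Dp c p := by
    rw [← Finset.sum_filter_add_sum_filter_not P (fun p => 0 ≤ Dp c p)]
    congr 1
    · exact Finset.sum_congr rfl fun p hp' => abs_of_nonneg (Finset.mem_filter.mp hp').2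
    · exact Finset.sum_congr rfl fun p hp' =>
        abs_of_neg (lt_of_not_ge (Finset.mem_filter.mp hp').2)
  have h2 : ∑ p ∈ P.filter (fun p => 0 ≤ Dp c p), Dp c p ≤ (D - H.C₁) / tauP 2 := by
    have hQ : ∀ p ∈ P.filter (fun p => 0 ≤ Dp c p), p.Prime :=
      fun p hp' => hP p (Finset.mem_filter.mp hp').1
    have hboost := boost_bound H _ hQ
    have hτ2 : 0 < tauP 2 := tauP_pos (by norm_num)
    rw [le_div_iff₀ hτ2]
    calc (∑ p ∈ P.filter (fun p => 0 ≤ Dp c p), Dp c p) * tauP 2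
        = ∑ p ∈ P.filter (fun p => 0 ≤ Dp c p), Dp c p * tauP 2 := by
          rw [Finset.sum_mul]
      _ ≤ ∑ p ∈ P.filter (fun p => 0 ≤ Dp c p), tauP p * Dp c p := by
          apply Finset.sum_le_sum
          intro p hp'
          obtain ⟨hpP, hDp⟩ := Finset.mem_filter.mp hp'
          calc Dp c p * tauP 2 = tauP 2 * Dp c p := mul_comm _ _
          _ ≤ tauP p * Dp c p :=
              mul_le_mul_of_nonneg_right (tauP_mono (hP p hpP) (hP p hpP).two_le) hDp
      _ ≤ D - H.C₁ := hboost
  have h3 : ∑ p ∈ P.filter (fun p => ¬ 0 ≤ Dp c p), -Dp c p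
      ≤ D + ∑' n, cWeight c n - H.C₁ := by
    have hR : ∀ p ∈ P.filter (fun p => ¬ 0 ≤ Dp c p), p.Prime :=
      fun p hp' => hP p (Finset.mem_filter.mp hp').1
    have heuler := euler_bound H _ hR
    have hs : ∑ p ∈ P.filter (fun p => ¬ 0 ≤ Dp c p), -Dp c p
        = -∑ p ∈ P.filter (fun p => ¬ 0 ≤ Dp c p), Dp c p := by
      rw [← Finset.sum_neg_distrib]
    rw [hs]
    linarith
  linarith

/-- `Σ_{p∈P} T₁(p) ≤ (17/8)(D - C₁)` (via (iv) and `τ'_p ≥ 8/17`). [folklore] -/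
lemma sum_T1p_le (H : TypeDesignHypotheses D c) (P : Finset ℕ)
    (hP : ∀ p ∈ P, p.Prime) :
    ∑ p ∈ P, T1p c p ≤ (17/8) * (D - H.C₁) := by
  classical
  have hQ : ∀ p ∈ P.filter (fun p => 0 ≤ T1p c p), p.Prime :=
    fun p hp' => hP p (Finset.mem_filter.mp hp').1
  have h3 := threeTerm_bound H _ hQ
  have h1 : ∑ p ∈ P, T1p c p ≤ ∑ p ∈ P.filter (fun p => 0 ≤ T1p c p), T1p c p := by
    rw [← Finset.sum_filter_add_sum_filter_not P (fun p => 0 ≤ T1p c p)]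
    have : ∑ p ∈ P.filter (fun p => ¬ 0 ≤ T1p c p), T1p c p ≤ 0 := by
      apply Finset.sum_nonpos
      intro p hp'
      exact le_of_lt (lt_of_not_ge (Finset.mem_filter.mp hp').2)
    linarith
  have h2 : (8/17) * ∑ p ∈ P.filter (fun p => 0 ≤ T1p c p), T1p c p ≤ D - H.C₁ := by
    calc (8/17) * ∑ p ∈ P.filter (fun p => 0 ≤ T1p c p), T1p c p
        = ∑ p ∈ P.filter (fun p => 0 ≤ T1p c p), (8/17) * T1p c p := by
          rw [Finset.mul_sum]
      _ ≤ ∑ p ∈ P.filter (fun p => 0 ≤ T1p c p), gTau p * T1p c p := by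
          apply Finset.sum_le_sum
          intro p hp'
          obtain ⟨hpP, hT⟩ := Finset.mem_filter.mp hp'
          exact mul_le_mul_of_nonneg_right (gTau_ge (hP p hpP)) hT
      _ ≤ D - H.C₁ := h3
  linarith

/-- For a prime power `n` with `minFac n = p`: `n = p^(v_p(n))` and `v_p(n) ≥ 1`. [folklore] -/
lemma primePow_eq_minFac_pow (hn : IsPrimePow n) :
    n.minFac.Prime ∧ 1 ≤ n.factorization n.minFac
      ∧ n = n.minFac ^ (n.factorization n.minFac) := by
  obtain ⟨r, k, hr, hk, hrk⟩ := (isPrimePow_nat_iff n).mp hn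
  have hrn : n.minFac = r := by
    rw [← hrk, Nat.pow_minFac hk.ne', hr.minFac_eq]
  have hfact : n.factorization n.minFac = k := by
    rw [hrn, ← hrk, hr.factorization_pow, Finsupp.single_eq_same]
  refine ⟨hrn ▸ hr, ?_, ?_⟩
  · rw [hfact]; exact hk
  · rw [hfact, hrn, hrk]

/-- Prop. 4.1(v): the ℓ¹-rigidity `Σ_n |c(n)-Λ(n)|/n < ∞`. [folklore] -/
theorem prop41_v (H : TypeDesignHypotheses D c) : Summable fun n : ℕ => |z c n| := by
  classical
  apply summable_of_sum_le
    (c := ∑' n, cWeight c n + ((D - H.C₁) / tauP 2 + (D + ∑' n, cWeight c n - H.C₁))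
      + 2 * ((17/8) * (D - H.C₁)) + 4 * ∑' m, logMaj m)
    (fun n => abs_nonneg _)
  intro F
  -- split off the composites
  rw [← Finset.sum_filter_add_sum_filter_not F (fun n => IsComposite n)]
  have hpiece1 : ∑ n ∈ F.filter (fun n => IsComposite n), |z c n| ≤ ∑' n, cWeight c n := by
    have hcongr : ∀ n ∈ F.filter (fun n => IsComposite n), |z c n| = cWeight c n := by
      intro n hn'
      have hcomp := (Finset.mem_filter.mp hn').2
      rw [z_eq_of_comp hcomp,
        abs_of_nonneg (div_nonneg (H.nonneg n) (Nat.cast_nonneg n))]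
      unfold cWeight
      rw [if_pos hcomp]
    rw [Finset.sum_congr rfl hcongr]
    exact Summable.sum_le_tsum _ (fun n _ => cWeight_nonneg H n) (prop41_i_summable H)
  -- the non-composites: `n < 2` contributes `0`; the rest are prime powers
  set F2 := (F.filter (fun n => ¬ IsComposite n)).filter (fun n => 2 ≤ n) with hF2
  have hpiece2a : ∑ n ∈ F.filter (fun n => ¬ IsComposite n), |z c n|
      = ∑ n ∈ F2, |z c n| := by
    rw [hF2, ← Finset.sum_filter_add_sum_filter_not
      (F.filter (fun n => ¬ IsComposite n)) (fun n => 2 ≤ n)]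
    have hz0 : ∑ n ∈ (F.filter (fun n => ¬ IsComposite n)).filter (fun n => ¬ 2 ≤ n),
        |z c n| = 0 := by
      apply Finset.sum_eq_zero
      intro n hn'
      have h2 := (Finset.mem_filter.mp hn').2
      have : n < 2 := by omega
      interval_cases n
      · rw [z_zero, abs_zero]
      · rw [z_one H.c_one, abs_zero]
    rw [hz0, add_zero]
  set M := F.sup id with hM
  set Pf := (range (M+1)).filter Nat.Prime with hPf
  have hPfP : ∀ p ∈ Pf, p.Prime := fun p hp' => (Finset.mem_filter.mp hp').2
  have hmaps : ∀ n ∈ F2, n.minFac ∈ Pf := by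
    intro n hn'
    have hmem := Finset.mem_filter.mp hn'
    have hmemF := Finset.mem_filter.mp hmem.1
    have h2 : 2 ≤ n := hmem.2
    have hpp : IsPrimePow n := by
      by_contra hnpp
      exact (hmemF.2) ⟨h2, hnpp⟩
    obtain ⟨hprime, _, _⟩ := primePow_eq_minFac_pow hpp
    rw [hPf, Finset.mem_filter, Finset.mem_range]
    have hle : n.minFac ≤ n := Nat.minFac_le (by omega)
    have hnM : n ≤ M := by
      rw [hM]
      exact Finset.le_sup (f := id) hmemF.1
    exact ⟨by omega, hprime⟩
  have hpiece2b : ∑ n ∈ F2, |z c n| ≤ ∑ p ∈ Pf, ∑' k : ℕ, |z c (p^(k+1))| := by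
    rw [← Finset.sum_fiberwise_of_maps_to hmaps (fun n => |z c n|)]
    apply Finset.sum_le_sum
    intro p hpPf
    -- the fiber over `p` consists of powers of `p`; inject into the exponents
    set fib := F2.filter (fun n => n.minFac = p) with hfib
    have hfib_pp : ∀ n ∈ fib, 1 ≤ n.factorization p ∧ n = p ^ (n.factorization p) := by
      intro n hn'
      have hmem := Finset.mem_filter.mp hn'
      have hmem2 := Finset.mem_filter.mp hmem.1
      have hmemF := Finset.mem_filter.mp hmem2.1
      have h2 : 2 ≤ n := hmem2.2
      have hpp : IsPrimePow n := by
        by_contra hnpp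
        exact (hmemF.2) ⟨h2, hnpp⟩
      obtain ⟨_, hone, heq⟩ := primePow_eq_minFac_pow hpp
      rw [hmem.2] at hone heq
      exact ⟨hone, heq⟩
    have hinj : ∀ a ∈ fib, ∀ b ∈ fib,
        a.factorization p - 1 = b.factorization p - 1 → a = b := by
      intro a ha b hb hab
      obtain ⟨ha1, haeq⟩ := hfib_pp a ha
      obtain ⟨hb1, hbeq⟩ := hfib_pp b hb
      have : a.factorization p = b.factorization p := by omega
      rw [haeq, hbeq, this]
    calc ∑ n ∈ fib, |z c n|
        = ∑ k ∈ fib.image (fun n => n.factorization p - 1), |z c (p^(k+1))| := by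
          rw [Finset.sum_image hinj]
          apply Finset.sum_congr rfl
          intro n hn'
          obtain ⟨h1, heq⟩ := hfib_pp n hn'
          congr 1
          rw [show n.factorization p - 1 + 1 = n.factorization p by omega]
          exact congrArg (z c) heq
      _ ≤ ∑' k : ℕ, |z c (p^(k+1))| :=
          Summable.sum_le_tsum _ (fun k _ => abs_nonneg _)
            (H.summable_pp p (hPfP p hpPf))
  have hZp : ∑ p ∈ Pf, ∑' k : ℕ, |z c (p^(k+1))|
      ≤ ∑ p ∈ Pf, (|Dp c p| + 2 * T1p c p + 4 * logMaj p) :=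
    Finset.sum_le_sum fun p hp' => Zp_le H (hPfP p hp')
  have hsplit3 : ∑ p ∈ Pf, (|Dp c p| + 2 * T1p c p + 4 * logMaj p)
      = (∑ p ∈ Pf, |Dp c p|) + 2 * (∑ p ∈ Pf, T1p c p) + 4 * ∑ p ∈ Pf, logMaj p := by
    rw [Finset.sum_add_distrib, Finset.sum_add_distrib, Finset.mul_sum, Finset.mul_sum]
  have hlog : ∑ p ∈ Pf, logMaj p ≤ ∑' m, logMaj m :=
    Summable.sum_le_tsum _ (fun m _ => logMaj_nonneg m) summable_logMaj
  have hD := sum_abs_Dp_le H Pf hPfP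
  have hT := sum_T1p_le H Pf hPfP
  have hpiece1' := hpiece1
  linarith [hpiece2a, hpiece2b, hZp, hsplit3, hlog, hD, hT]

/-- After (v): the ordered sum equals the unconditional sum, `Σ' z = C₁`. [folklore] -/
theorem tsum_z_eq (H : TypeDesignHypotheses D c) : ∑' n, z c n = H.C₁ := by
  have hs : Summable (z c) := (prop41_v H).of_abs
  exact tendsto_nhds_unique hs.hasSum.tendsto_sum_nat H.tendsto_C₁

/-! ## The `e₂`-weighted composite mass (W-MAG Prop. 4.3(i): the AX-B input of the deficit spine) -/

/-- `e₂(n) = ∑_{q < q'} τ_q τ_{q'}` over pairs of distinct prime divisors of `n` (2001 W-MAG §4, display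
before Prop. 4.3; `e₂(0) = e₂(1) = 0`). [folklore] -/
def eTwo (n : ℕ) : ℝ :=
  ∑ q ∈ n.primeFactors, ∑ q' ∈ n.primeFactors.filter (fun q' => q < q'), tauP q * tauP q'

/-- The `e₂`-weighted composite-mass summand `𝟙_{n ≥ 2, n not a prime power}·(c(n)/n)·e₂(n)`
(2001 W-MAG Prop. 4.3(i)). [folklore] -/
def compMass (c : ℕ → ℝ) (n : ℕ) : ℝ :=
  if 2 ≤ n ∧ ¬ IsPrimePow n then c n / n * eTwo n else 0

/-- `e₂ ≥ 0`. [folklore] -/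
lemma eTwo_nonneg (n : ℕ) : 0 ≤ eTwo n := by
  unfold eTwo
  refine Finset.sum_nonneg fun q hq => Finset.sum_nonneg fun q' hq' => ?_
  exact mul_nonneg (tauP_nonneg (Nat.prime_of_mem_primeFactors hq))
    (tauP_nonneg (Nat.prime_of_mem_primeFactors (Finset.mem_filter.mp hq').1))

/-- The `e₂`-weighted composite mass summand is nonnegative for `c ≥ 0`. [folklore] -/
lemma compMass_nonneg (hc : ∀ n, 0 ≤ c n) (n : ℕ) : 0 ≤ compMass c n := by
  unfold compMass
  split
  · exact mul_nonneg (div_nonneg (hc n) (Nat.cast_nonneg n)) (eTwo_nonneg n)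
  · exact le_rfl

/-- The pairs `q < q'` of prime divisors inject into the even nonempty subsets: `e₂(n) ≤ evenΦ_P(n) − 1`
whenever `P ⊇` the prime factors of `n ≠ 0` (2001 W-MAG proof of Prop. 4.3(i): "`ρ − 1 = e₂ + e₄ + ⋯ ≥ e₂`").
[folklore] -/
lemma eTwo_le_evenPhi_sub_one (P : Finset ℕ) (hP : ∀ p ∈ P, p.Prime) {n : ℕ} (hn : n ≠ 0)
    (hsub : n.primeFactors ⊆ P) : eTwo n ≤ evenPhi P n - 1 := by
  classical
  have hT : P.filter (· ∣ n) = n.primeFactors := by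
    ext q
    rw [Finset.mem_filter, Nat.mem_primeFactors]
    constructor
    · rintro ⟨hqP, hqn⟩
      exact ⟨hP q hqP, hqn, hn⟩
    · rintro ⟨hq, hqn, -⟩
      exact ⟨hsub (Nat.mem_primeFactors.2 ⟨hq, hqn, hn⟩), hqn⟩
  set T := n.primeFactors with hTdef
  -- the pair sum as a sum over the images `{q, q'}`
  set pairs := (T ×ˢ T).filter (fun x : ℕ × ℕ => x.1 < x.2) with hpairs
  have he : eTwo n = ∑ x ∈ pairs, tauP x.1 * tauP x.2 := by
    unfold eTwo
    rw [hpairs, Finset.sum_filter, Finset.sum_product]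
    refine Finset.sum_congr rfl fun q _ => ?_
    rw [Finset.sum_filter]
  have hinj : Set.InjOn (fun x : ℕ × ℕ => ({x.1, x.2} : Finset ℕ)) pairs := by
    rintro ⟨a, b⟩ hab ⟨a', b'⟩ hab' h
    simp only [hpairs, Finset.coe_filter, Set.mem_setOf_eq, Finset.mem_product] at hab hab'
    have h' : ({a, b} : Finset ℕ) = {a', b'} := h
    have h1 : a ∈ ({a', b'} : Finset ℕ) := by rw [← h']; simp
    have h2 : b ∈ ({a', b'} : Finset ℕ) := by rw [← h']; simp
    have h3 : a' ∈ ({a, b} : Finset ℕ) := by rw [h']; simp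
    simp only [Finset.mem_insert, Finset.mem_singleton] at h1 h2 h3
    have hlt := hab.2
    have hlt' := hab'.2
    have ha : a = a' := by omega
    have hb : b = b' := by omega
    rw [ha, hb]
  have himg : ∑ B ∈ pairs.image (fun x : ℕ × ℕ => ({x.1, x.2} : Finset ℕ)), ∏ r ∈ B, tauP r =
      ∑ x ∈ pairs, tauP x.1 * tauP x.2 := by
    rw [Finset.sum_image hinj]
    refine Finset.sum_congr rfl fun x hx => ?_
    have hlt : x.1 < x.2 := (Finset.mem_filter.mp hx).2
    rw [Finset.prod_pair hlt.ne]
  -- the images are even nonempty subsets of `T`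
  have hsubset : pairs.image (fun x : ℕ × ℕ => ({x.1, x.2} : Finset ℕ)) ⊆
      ((P.filter (· ∣ n)).powerset.filter (fun B => Even B.card)).erase ∅ := by
    intro B hB
    obtain ⟨x, hx, rfl⟩ := Finset.mem_image.mp hB
    obtain ⟨hxT, hlt⟩ := Finset.mem_filter.mp hx
    rw [Finset.mem_product] at hxT
    rw [Finset.mem_erase, Finset.mem_filter, Finset.mem_powerset, hT]
    refine ⟨(Finset.insert_ne_empty _ _), ?_, ?_⟩
    · intro r hr
      simp only [Finset.mem_insert, Finset.mem_singleton] at hr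
      rcases hr with rfl | rfl
      · exact hxT.1
      · exact hxT.2
    · rw [Finset.card_pair hlt.ne]
      decide
  have hnn : ∀ B ∈ ((P.filter (· ∣ n)).powerset.filter (fun B => Even B.card)).erase ∅,
      (0:ℝ) ≤ ∏ r ∈ B, tauP r := by
    intro B hB
    apply Finset.prod_nonneg
    intro r hrB
    have hB' := (Finset.mem_filter.mp (Finset.mem_erase.mp hB).2).1
    have hrP : r ∈ P := Finset.filter_subset _ _ ((Finset.mem_powerset.mp hB') hrB)
    exact tauP_nonneg (hP r hrP)
  have hsplit : evenPhi P n - 1 =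
      ∑ B ∈ ((P.filter (· ∣ n)).powerset.filter (fun B => Even B.card)).erase ∅, ∏ r ∈ B, tauP r := by
    unfold evenPhi
    have hmem : (∅ : Finset ℕ) ∈ (P.filter (· ∣ n)).powerset.filter (fun B => Even B.card) := by
      rw [Finset.mem_filter]
      exact ⟨Finset.empty_mem_powerset _, by simp⟩
    rw [← Finset.add_sum_erase _ _ hmem, Finset.prod_empty]
    ring
  rw [hsplit, he, ← himg]
  exact Finset.sum_le_sum_of_subset_of_nonneg hsubset (fun B hB _ => hnn B hB)

/-- W-MAG Prop. 4.3(i), partial-sum form: `∑_{n∈F} (c(n)/n) e₂(n) 𝟙_{comp} ≤ D − C₁`. [folklore] -/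
lemma sum_compMass_le (H : TypeDesignHypotheses D c) (F : Finset ℕ) :
    ∑ n ∈ F, compMass c n ≤ D - H.C₁ := by
  classical
  set M := F.sup id with hM
  set P := (range (M+1)).filter Nat.Prime with hPdef
  have hP : ∀ p ∈ P, p.Prime := fun p hp' => (Finset.mem_filter.mp hp').2
  obtain ⟨hsum, hbound⟩ := even_design H P hP
  have hpt : ∀ n ∈ F, compMass c n ≤ z c n * (evenPhi P n - 1) := by
    intro n hnF
    unfold compMass
    split
    · rename_i hcomp
      have hcomp' : IsComposite n := hcomp
      have hn0 : n ≠ 0 := by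
        have := hcomp.1
        omega
      have hnM : n ≤ M := by
        rw [hM]
        exact Finset.le_sup (f := id) hnF
      have hsub : n.primeFactors ⊆ P := by
        intro q hq
        rw [hPdef, Finset.mem_filter, Finset.mem_range]
        have hle := Nat.le_of_mem_primeFactors hq
        exact ⟨by omega, Nat.prime_of_mem_primeFactors hq⟩
      rw [z_eq_of_comp hcomp']
      exact mul_le_mul_of_nonneg_left (eTwo_le_evenPhi_sub_one P hP hn0 hsub)
        (div_nonneg (H.nonneg n) (Nat.cast_nonneg n))
    · exact z_mul_evenR_nonneg H P hP n
  have hsumF : ∑ n ∈ F, compMass c n ≤ ∑ n ∈ F, z c n * (evenPhi P n - 1) := Finset.sum_le_sum hpt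
  have htail : ∑ n ∈ F, z c n * (evenPhi P n - 1) ≤ ∑' n, z c n * (evenPhi P n - 1) :=
    Summable.sum_le_tsum F (fun n _ => z_mul_evenR_nonneg H P hP n) hsum
  linarith

/-- **W-MAG Prop. 4.3(i) (AX-B)**: the `e₂`-weighted composite mass `∑_{n composite} (c(n)/n) e₂(n)` of a weight
satisfying the type inequality with defect `D` is finite. [folklore] -/
theorem summable_compMass (H : TypeDesignHypotheses D c) : Summable (compMass c) :=
  summable_of_sum_le (compMass_nonneg H.nonneg) (sum_compMass_le H)

/-- **W-MAG Prop. 4.3(i) (AX-B), the bound**: `∑_{n composite} (c(n)/n) e₂(n) ≤ D − C₁`. [folklore] -/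
theorem tsum_compMass_le (H : TypeDesignHypotheses D c) : ∑' n, compMass c n ≤ D - H.C₁ :=
  (summable_compMass H).tsum_le_of_sum_le (sum_compMass_le H)

/-! ## Smoke tests (non-vacuity) -/

/-- The hypothesis interface is satisfiable: `c = Λ` (so `z ≡ 0`) satisfies every
field with `C₁ = 0`.  (This does NOT establish the analytic content for general
`c ∈ K` — the paper does; it certifies that the interface is consistent and that
the conditional theorems have a model.) [folklore] -/
noncomputable def hypLambda : TypeDesignHypotheses 0 (fun n : ℕ => Λ n) where
  C₁ := 0
  nonneg := fun _ => vonMangoldt_nonneg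
  c_zero := by simp
  c_one := ArithmeticFunction.vonMangoldt_apply_one
  summable_pp := by
    intro p hp
    have hz : ∀ k : ℕ, |z (fun n : ℕ => Λ n) (p^(k+1))| = 0 := by
      intro k
      unfold z
      simp
    exact summable_zero.congr fun k => (hz k).symm
  summable_comp := by
    intro p hp
    have hz : ∀ n : ℕ, (if p ∣ n ∧ IsComposite n then Λ n / (n:ℝ) else 0) = 0 := by
      intro n
      split
      · rename_i h
        rw [ArithmeticFunction.vonMangoldt_eq_zero_iff.mpr h.2.2, zero_div]
      · rfl
    exact summable_zero.congr fun n => (hz n).symm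
  tendsto_C₁ := by
    have hz : ∀ N : ℕ, ∑ n ∈ range N, z (fun n : ℕ => Λ n) n = 0 := by
      intro N
      apply Finset.sum_eq_zero
      intro n _
      unfold z
      simp
    simp only [hz]
    exact tendsto_const_nhds
  type_ineq := by
    intro l₁ l₂ P₁ P₂ m₁ m₂ v₁ v₂ hl₁ hl₂ hP₁ hP₂ _
    have hz : ∀ n : ℕ, z (fun n : ℕ => Λ n) n = 0 := by
      intro n
      unfold z
      simp
    have h0 : ∀ n : ℕ, z (fun n : ℕ => Λ n) n *
        (designProfile l₁ l₂ P₁ P₂ m₁ m₂ v₁ v₂ n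
          - designProfile l₁ l₂ P₁ P₂ m₁ m₂ v₁ v₂ 1) = 0 := by
      intro n
      rw [hz n, zero_mul]
    rw [tsum_congr h0, tsum_zero, mul_zero, add_zero, zero_mul]


end

end TypeDesign

end Literature.NumberTheory.LFunctions
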